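import Literature.NumberTheory.Rogawski1990.RankOneUnstableWildLawTorusFold         -- ★ p844200 + p844308 F0P3-p01 (g14): the fold (the CONSUMER's binder texts `hjo hdeep hwin htop` are its)
import Literature.NumberTheory.Rogawski1990.RankOneKappaOrbitalShellDressTorus      -- ★ p844241∕p844255∕p844317 A-p13 (g32) (B6-H): `forall_exists_descent_eq_smul_regRep_of_pos`
import Literature.NumberTheory.Rogawski1990.RankOneUnstableWildTorusWrapper         -- ★ p844450 B-p12 (g30) (B6-O) FILE B: frame ∕ depth bookkeeping (`descent_scalars_ne_zero`, …)
import Literature.NumberTheory.Rogawski1990.RankOneKappaShellConjugateDescent       -- ★ p844379 B-p14 (g33) (B6-V) descent package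
import Literature.NumberTheory.Rogawski1990.RankOneUnstableWildWindowLaw            -- ★ p844448 B-p14 (g33) (B6-V) (V-win) V2: `exists_windowForms_setIntegral_shellConjugate_sub_eq_hilbertSymbol_mul`
import Literature.NumberTheory.Rogawski1990.RankOneUnstableWildWindowSideAssembly     -- ★ p844648 B-p14 (g34) (B6-V) ASSEMBLER `exists_wildValueLaws_of_frontHalf` (over ★ p844613 window side: hwin ∧ hΦ ∧ hΦD ∧ hcont)
import Literature.NumberTheory.Rogawski1990.RankOneKappaShellAverageDeepAnyAlpha      -- ★ p844557 B-p10 (g27) (B6-V) (V-deep), any anti-fixed `α`: `exists_depth_shellAverage_eq_of_descent_congr'`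
import Literature.NumberTheory.Rogawski1990.RankOneUnstableWildTopVanishing           -- ★ p844471 A-p17 (g23) (B6-V) (V-top): `exists_setIntegral_shellConj_eq_zero_of_lt`
import Literature.NumberTheory.Rogawski1990.RankOneUnstableWildEigenLabels             -- ★ p844311 A-p03 (g26): `eigen_labels_of_descent_frame`, `deep_bounds_of_valued_sub_lt`
import Literature.NumberTheory.Automorphic.ValuedFieldValuativeRelBridge               -- ★ `v_eq_iff_valuation_eq`, `mem_glInt_iff_forall_v_le_one`, `isDiscreteValuationRing_integer_of_compatible`
import Literature.NumberTheory.LocalFields.QuadraticOrderDeepShells                    -- ★ p844005 A-p12 (Ψ2): `forall_v_shellConj_sub_smul_one_le`, `forall_v_diagonal_conj_sub_smul_one_le`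
import HarnessLib

/-!
# (B6-V) «THE VALUE LAWS ON THE TORUS» — HEAD `exists_wildValueLaws` (road «W′» = «R1LL-WILD»; Labesse–Langlands (2.1)–(2.2), Labesse 2024 Prop. 0.0.11 ∕ Th. 0.0.12)

Topic `NumberTheory/Rogawski1990`; namespace `Literature.NumberTheory.Rogawski1990`.  THEOREMS ONLY (no definition, no instance, no notation, no named fact,
no `sorry`).  Cell `pub/hodgecm-mathlib` (D-0151), crux H413 = `stmt-HodgeConjecture-24833`, line «N6nsGerm», wild residue `stub_N6nsR1ramWild`; (B6-V) HEAD held by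
F0P3a-p08 (g16) (architect A-p16 (g28) 13:04:35Z; design of record = B-p14 (g33) `HANDOFF-B6V-HEAD.B-p14g33.md` 30fdf257 §3).  CONSUMER: the (W′-B6) CLOSE
`exists_wildLaw_torus` of F0P3-p01 (g15) — the conclusion below is his `hV` TEXT OF RECORD v3 (`hV-text-of-record.v3.F0P3p01g15.lean.txt` 1f74610d) token for token
(binders `(mfl j R) (oT κT) (Φ ΦD) (Nf NDf)`, conjuncts `hjo ∧ hdeep ∧ hwin ∧ htop ∧ hΦ ∧ hΦD ∧ hcont ∧ hspec`, the last one = the (B6-O) interface of ★ B-p12 (g30)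
`exists_depth_sign_dictionary_torus_of_symbol`); the binders are a SUBSET of the CLOSE's v4 list (unused ones dropped, order kept) plus ONE ★-derivable fact `hτne : τE ≠ σ_w τE`
(F0P3-p01 derives it in the CLOSE, `ne_galAdicCompletionMap_of_eisenstein`).  HONEST LABEL: HC_CM is proved only modulo the 2 remaining named inputs (hLiu418, h413) until
rung 0 closes; this file is unconditional.

THE MATHEMATICS (LL79 §2 pp. 8–10; Labesse 2024 §0).  Along the framed elliptic torus `Z(t₀) ⊂ H_v = U(Φ₂)_v × U(Φ₁)_v` at a RAMIFIED non-split `w ∣ v`, every `t` descends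
(`hpos`, standard position) as `diag(1,α)·X_t·diag(1,α)⁻¹ = s_t·ι_w(a_t + b_t M_τ)` with `X_t := ↑↑(E₂ (↑t).1)`; the Eisenstein COORDINATES are the corner `ζ t := (X_t)₀₀ = s_t ι a_t`
and the window coordinate `β t := b_t ∕ a_t` (so `ι β t = α (X_t)₁₀ ∕ (X_t)₀₀`, ★ `toPlace_div_eq_windowCoord`), with depth `oT t := ord_v β t` and sign `κT t := (β t, θ)_v`.
ON THE DEEP REGULAR LOCUS `mfl ≤ N t` (`N t = ord_w(x₀ t − x₁ t)`, the fold's depth): the frame column lies on a `t`-free eigenline (★ B-p12 `frame_column_cases`), the labelled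
eigenvalues are `x₀ = s(ιa + ιb τ)`, `x₁ = s(ιa + ιb τ′)` (★ A-p03 `eigen_labels_of_descent_frame`), and ★ `deep_bounds_of_valued_sub_lt` gives `a ≠ 0`, `|s ι a| = 1` and
**`|ι β|_w · |τE − σ τE|_w = |x₀ − x₁|_w = exp(−N t)`** — whence (e(w|v) = 2) `2·oT t = N t − ord_w(τE − σ τE)`, `jD ≤ oT t` past the threshold, and the `a = 1` normal form
`diag(1,α) X_t diag(1,α)⁻¹ = ζ t • ι(1, β v₀; β, 1 + β u₀)`.  Then: (hdeep) = ★ B-p10 `exists_depth_shellAverage_eq_of_descent_congr'` (any anti-fixed `α`) at the shell conjugates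
`S := (D_c^m)⁻¹ N(β) D_c^m` (★ B-p14 `descent_shellConjugate`, `c = N(ηE)`) and `S′ := D_{u_F} S D_{u_F}⁻¹` (partner `e t`: `hconj` + ★ A-p13 `descent_conj_diagonal_eq`), the two
congruences `S ≡ 1 ≡ S′ (mod exp(−jD))` from `m + jD ≤ oT t` by (Ψ2) ★ `forall_v_shellConj_sub_smul_one_le` ∕ `forall_v_diagonal_conj_sub_smul_one_le`; (htop) = ★ A-p17
`exists_setIntegral_shellConj_eq_zero_of_lt` at `D := 1` (for `t`) and `D := D_{u_F} ∈ GL₂(𝒪)` (for `e t`); and the window side `hwin ∧ hΦ ∧ hΦD ∧ hcont`, `hjo`, `hspec` are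
★ B-p14 (g34) `exists_wildValueLaws_of_frontHalf` (over ★ `exists_windowSide_of_coords`, ★ V2 p844448, ★ B-p04 (Ψ3) continuity) fed with `(mfl, jD, R, ζ, β, oT, hnf, h00, hoT, hdeep, htop)`.

* §0 (private, place-blind) `smul_map_regRep_eq_smul_map_regRepOne` (the `a = 1` normal form), `diagonal_pair_eq_smul_one`, `diag_one_conj_apply_entries`, and four isolated
  linear-arithmetic facts (`int_eq_of_two_mul_eq_two_mul`, `thresholds_of_le`, `depth_arith`, `neg_add_le_neg_of_add_le`, `sub_add_add_eq_of_le`).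
* §1 **`exists_wildValueLaws`** — the HEAD.

## References
* [LabesseLanglands1979] J.-P. Labesse, R. P. Langlands, *L-indistinguishability for SL(2)*, Canad. J. Math. 31 (1979): §2 (2.1)–(2.2) pp. 8–10.
* [Labesse2024StabilisationGermesSL2] J.-P. Labesse, *Stabilisation des germes de SL(2)* (arXiv:2411.14820): Prop. 0.0.10–0.0.11, Th. 0.0.12 pp. 7–8.
* [Rogawski1990] J. D. Rogawski, *Automorphic Representations of Unitary Groups in Three Variables*, Ann. of Math. Stud. 123 (1990): §3.6 pp. 31–32; §4.9 Lemma 4.9.3 p. 56.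
-/

set_option autoImplicit false

noncomputable section

open Set Filter Topology MeasureTheory NumberField IsDedekindDomain Finset Matrix ValuativeRel Function MulAction
open scoped Matrix MatrixGroups ValuativeRel WithZero

namespace Literature.NumberTheory.Rogawski1990

open Literature.NumberTheory.Automorphic Literature.NumberTheory.Automorphic.UnitaryGroup Literature.NumberTheory.GaloisRepresentations
open Literature.NumberTheory.QuadraticForms Literature.NumberTheory.NumberFields Literature.NumberTheory.Automorphic.HermitianLatticeTree

/-! ## §0 Three lines of matrix algebra (place-blind) -/

section Generic

/-- The `a = 1` normal form of a descended torus element: `s • ι(a, b v₀; b, a + b u₀) = (s·ι a) • ι(1, β v₀; β, 1 + β u₀)` with `β = b∕a` (`a ≠ 0`).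
[cite: LabesseLanglands1979, §2 (2.1) p. 8] -/
private theorem smul_map_regRep_eq_smul_map_regRepOne {F E : Type*} [Field F] [Field E] (ι : F →+* E) (s : E) {a b u₀ v₀ : F} (ha : a ≠ 0) :
    s • (!![a, b * v₀; b, a + b * u₀]).map ι = (s * ι a) • (!![(1 : F), (b / a) * v₀; b / a, 1 + (b / a) * u₀]).map ι := by
  have hιa : ι a ≠ 0 := (map_ne_zero ι).2 ha
  ext i k
  fin_cases i <;> fin_cases k <;> simp [Matrix.smul_apply, map_div₀] <;> field_simp

/-- `diag(x, x) = x • 1`. [folklore] -/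
private theorem diagonal_pair_eq_smul_one {R : Type*} [CommRing R] (x : R) :
    Matrix.diagonal ![x, x] = x • (1 : Matrix (Fin 2) (Fin 2) R) := by
  ext i k
  fin_cases i <;> fin_cases k <;> simp

/-- The `(0,0)` and `(1,0)` entries of `diag(1, α)·X·diag(1, α⁻¹)` are `X₀₀` and `α·X₁₀`. [cite: LabesseLanglands1979, §2 (2.1) p. 8] -/
private theorem diag_one_conj_apply_entries {E : Type*} [Field E] (X : Matrix (Fin 2) (Fin 2) E) (α : E) :
    (Matrix.diagonal ![1, α] * X * Matrix.diagonal ![1, α⁻¹]) 0 0 = X 0 0 ∧ (Matrix.diagonal ![1, α] * X * Matrix.diagonal ![1, α⁻¹]) 1 0 = α * X 1 0 := by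
  rw [Matrix.mul_diagonal, Matrix.mul_diagonal, Matrix.diagonal_mul, Matrix.diagonal_mul]
  simp

/-- `2k = 0 ⇒ k = 0` and `2k = 2·(−1) ⇒ k = −1` in `ℤ` (isolated). [folklore] -/
private theorem int_eq_of_two_mul_eq_two_mul {k c : ℤ} (h : 2 * k = 2 * c) : k = c := by
  omega

/-- Threshold bookkeeping (linear arithmetic, isolated from the large context of the head). [folklore] -/
private theorem thresholds_of_le {A j δn N : ℕ} (h : A + 1 + 2 * j + δn ≤ N) : A + 1 ≤ N ∧ δn ≤ N ∧ 2 * j + δn ≤ N := by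
  omega

/-- The depth dictionary `2·log|β| − δ = −N` read as `oT = −log|β| ≥ j`, `2·oT = N − δ` (linear arithmetic, isolated). [folklore] -/
private theorem depth_arith {N j δn : ℕ} {k δ : ℤ} (hlin : 2 * k + -δ = -(N : ℤ)) (hδ : δ ≤ (δn : ℤ)) (hδN : δn ≤ N) (hj : 2 * j + δn ≤ N) :
    0 ≤ -k ∧ (j : ℤ) ≤ -k ∧ 2 * -k = (N : ℤ) - δ := by
  omega

/-- `m + j ≤ o ⇒ −o + m ≤ −j` in `ℤ` (isolated). [folklore] -/
private theorem neg_add_le_neg_of_add_le {m j o : ℕ} (h : m + j ≤ o) : -(o : ℤ) + (m : ℤ) ≤ -(j : ℤ) := by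
  omega

/-- `j ≤ o ⇒ (o − j + i) + j = o + i` in `ℕ` (isolated). [folklore] -/
private theorem sub_add_add_eq_of_le {o j i : ℕ} (h : j ≤ o) : o - j + i + j = o + i := by
  omega

end Generic

section ValueLaws

variable (L : Type) [Field L] [NumberField L] [IsCMField L] (v : HeightOneSpectrum (𝓞 ↥(maximalRealSubfield L)))
  (w : PlacesOver L v) (hw : IsCMField.complexConj L • w.1 = w.1)
  [MeasurableSpace ((cmDatum L 2 (Matrix.of fun i j : Fin 2 => if i.val + j.val + 1 = 2 then (1 : L) else 0)).Local v × (cmDatum L 1 (Matrix.of fun i j : Fin 1 => if i.val + j.val + 1 = 1 then (1 : L) else 0)).Local v)] [BorelSpace ((cmDatum L 2 (Matrix.of fun i j : Fin 2 => if i.val + j.val + 1 = 2 then (1 : L) else 0)).Local v × (cmDatum L 1 (Matrix.of fun i j : Fin 1 => if i.val + j.val + 1 = 1 then (1 : L) else 0)).Local v)] (ν : Measure ((cmDatum L 2 (Matrix.of fun i j : Fin 2 => if i.val + j.val + 1 = 2 then (1 : L) else 0)).Local v × (cmDatum L 1 (Matrix.of fun i j : Fin 1 => if i.val + j.val + 1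 = 1 then (1 : L) else 0)).Local v)) [ν.IsHaarMeasure]
  (f : ((cmDatum L 2 (Matrix.of fun i j : Fin 2 => if i.val + j.val + 1 = 2 then (1 : L) else 0)).Local v × (cmDatum L 1 (Matrix.of fun i j : Fin 1 => if i.val + j.val + 1 = 1 then (1 : L) else 0)).Local v) → ℂ) (hf : IsLocSmooth f)
  (t₀ : ((cmDatum L 2 (Matrix.of fun i j : Fin 2 => if i.val + j.val + 1 = 2 then (1 : L) else 0)).Local v × (cmDatum L 1 (Matrix.of fun i j : Fin 1 => if i.val + j.val + 1 = 1 then (1 : L) else 0)).Local v)) (P : GL (Fin 2) (LocalRing L v)) (d : Fin 2 → LocalRing L v) (ht₀ : IsRegularElt (t₀.1.val : GL (Fin 2) (LocalRing L v)))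
  (hP : (t₀.1.val.val : Matrix (Fin 2) (Fin 2) (LocalRing L v)) * P.val = P.val * Matrix.diagonal d) (hd1 : ∀ i, conjLocal L (IsCMField.complexConj L) v (d i) * d i = 1)

-- `L_w`-sized statement: elaboration budget only (no search)
set_option maxHeartbeats 1600000 in
include hw hf ht₀ hP hd1 in
/-- **(B6-V) THE VALUE LAWS ON THE TORUS** (Labesse–Langlands (2.1)–(2.2) ∕ Labesse 2024 Prop. 0.0.11, Th. 0.0.12, read along the framed elliptic torus `Z(t₀)` of `U(Φ₂)_v × U(Φ₁)_v`
at a RAMIFIED non-split `w ∣ v`): window bottom `mfl`, level `j`, support radius `R`, window depth `oT`, sign `κT`, window averages `Φ ΦD` with their continuous families `Nf NDf`,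
satisfying (hjo) `j ≤ oT t`, (hdeep) deep shell averages of `t` and `e t` agree, (hwin) the window law `fbar_{oT t − j + i}(t) − fbar_{oT t − j + i}(e t) = κT t·(Φ i t − ΦD i t)`, (htop) top
vanishing past `oT t + R`, (hΦ∕hΦD) the averages as `K × U(Φ₁)`-orbital means of `Nf∕NDf`, (hcont) continuity of the families at the singular points, and (hspec) the (B6-O) interface
`∃ βF, ι_w βF = α·T₁₀∕T₀₀ ∧ |βF|_v = exp(−oT t) ∧ κT t = (βF, θ)_v` — all on the deep regular locus `mfl ≤ N t`.
[cite: LabesseLanglands1979, §2 (2.1)–(2.2) pp. 8–10] [cite: Labesse2024StabilisationGermesSL2, Prop. 0.0.11, Th. 0.0.12] [cite: Rogawski1990, §4.9 Lemma 4.9.3 p. 56] -/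
theorem exists_wildValueLaws
    (he : v.asIdeal.ramificationIdx' w.1.asIdeal ≠ 1)
    (u : ((w.1.adicCompletion L))ˣ) (hvu : Valued.v (u : (w.1.adicCompletion L)) = 1) (hσu : (galAdicCompletionMap (L := L) (IsCMField.complexConj L) hw) (u : (w.1.adicCompletion L)) = u) (hun : ¬ ∃ z : (w.1.adicCompletion L), (u : (w.1.adicCompletion L)) = (galAdicCompletionMap (L := L) (IsCMField.complexConj L) hw) z * z)
    (E₂ : (cmDatum L 2 (Matrix.of fun i j : Fin 2 => if i.val + j.val + 1 = 2 then (1 : L) else 0)).Local v ≃ₜ* ↥(unitaryGroupOfForm (galAdicCompletionMap (L := L) (IsCMField.complexConj L) hw) (placeForm (Matrix.of fun i j : Fin 2 => if i.val + j.val + 1 = 2 then (1 : L) else 0) w.1))) (hE₂ : ∀ g, ((E₂ g : ↥(unitaryGroupOfForm (galAdicCompletionMap (L := L) (IsCMField.complexConj L) hw) (placeForm (Matrix.of fun i j : Fin 2 => if i.val + j.val + 1 = 2 then (1 : L) else 0) w.1))) : GL (Fin 2) (w.1.adicCompletion L)) = ((localNonsplitEquiv (IsCMField.complexConj L) (Matrix.of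 fun i j : Fin 2 => if i.val + j.val + 1 = 2 then (1 : L) else 0) (IsCMField.complexConj_ne_one L) w hw g : ↥(unitaryGroupOfForm (galAdicCompletionMap (L := L) (IsCMField.complexConj L) hw) (placeForm (Matrix.of fun i j : Fin 2 => if i.val + j.val + 1 = 2 then (1 : L) else 0) w.1))) : GL (Fin 2) (w.1.adicCompletion L)))
    (e : ((cmDatum L 2 (Matrix.of fun i j : Fin 2 => if i.val + j.val + 1 = 2 then (1 : L) else 0)).Local v × (cmDatum L 1 (Matrix.of fun i j : Fin 1 => if i.val + j.val + 1 = 1 then (1 : L) else 0)).Local v) ≃ₜ* ((cmDatum L 2 (Matrix.of fun i j : Fin 2 => if i.val + j.val + 1 = 2 then (1 : L) else 0)).Local v × (cmDatum L 1 (Matrix.of fun i j : Fin 1 => if i.val + j.val + 1 = 1 then (1 : L) else 0)).Local v)) (he2 : ∀ a : ((cmDatum L 2 (Matrix.of fun i j : Fin 2 => if i.val + j.val + 1 = 2 then (1 : L) else 0)).Local v × (cmDatum L 1 (Matrix.of fun i j : Fin 1 => if i.val + j.val + 1 = 1 then (1 : L) else 0)).Local v), (e a).2 = a.2)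
    (hconj : ∀ a : ((cmDatum L 2 (Matrix.of fun i j : Fin 2 => if i.val + j.val + 1 = 2 then (1 : L) else 0)).Local v × (cmDatum L 1 (Matrix.of fun i j : Fin 1 => if i.val + j.val + 1 = 1 then (1 : L) else 0)).Local v), ((E₂ (e a).1 : ↥(unitaryGroupOfForm (galAdicCompletionMap (L := L) (IsCMField.complexConj L) hw) (placeForm (Matrix.of fun i j : Fin 2 => if i.val + j.val + 1 = 2 then (1 : L) else 0) w.1))) : GL (Fin 2) (w.1.adicCompletion L)) = (glDiagonal 2 (w.1.adicCompletion L) ![1, u]) * ((E₂ a.1 : ↥(unitaryGroupOfForm (galAdicCompletionMap (L := L) (IsCMField.complexConj L) hw) (placeForm (Matrix.of fun i j : Fin 2 => if i.val + j.val + 1 = 2 then (1 : L) else 0) w.1))) : GL (Fin 2) (w.1.adicCompletion L)) * ((glDiagonal 2 (w.1.adicCompletion L) ![1, u]))⁻¹)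
    -- the tree ∕ Eisenstein block (A-p13 (g32) (B6-H) spelling of record) and STANDARD POSITION
    {α : (w.1.adicCompletion L)} (hα : (galAdicCompletionMap (L := L) (IsCMField.complexConj L) hw) α = -α) (hα0 : α ≠ 0)
    {ϖF : v.adicCompletion ↥(maximalRealSubfield L)} (hϖF : Valued.v ϖF = WithZero.exp (-1 : ℤ))
    (K : Subgroup ((cmDatum L 2 (Matrix.of fun i j : Fin 2 => if i.val + j.val + 1 = 2 then (1 : L) else 0)).Local v))
    (x₀ : {M : Submodule 𝒪[v.adicCompletion ↥(maximalRealSubfield L)] (Fin 2 → v.adicCompletion ↥(maximalRealSubfield L)) // IsSpecialLattice (RingHom.id _) ϖF !![(0 : v.adicCompletion ↥(maximalRealSubfield L)), 1; -1, 0] M})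
    (hx₀ : x₀.1 = latt (1 : Matrix (Fin 2) (Fin 2) (v.adicCompletion ↥(maximalRealSubfield L))))
    (hK : ∀ g, g ∈ K ↔ rhoVertexActPlace L v w hw hα hα0 hϖF (E₂ g) x₀ = x₀) (hKo : IsOpen ((((K.prod (⊤ : Subgroup ((cmDatum L 1 (Matrix.of fun i j : Fin 1 => if i.val + j.val + 1 = 1 then (1 : L) else 0)).Local v))) : Subgroup ((cmDatum L 2 (Matrix.of fun i j : Fin 2 => if i.val + j.val + 1 = 2 then (1 : L) else 0)).Local v × (cmDatum L 1 (Matrix.of fun i j : Fin 1 => if i.val + j.val + 1 = 1 then (1 : L) else 0)).Local v))) : Set ((cmDatum L 2 (Matrix.of fun i j : Fin 2 => if i.val + j.val + 1 = 2 then (1 : L) else 0)).Local v × (cmDatum L 1 (Matrix.of fun i j : Fin 1 => if i.val + j.val + 1 = 1 then (1 : L) else 0)).Local v)))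
    (hKc : IsCompact ((((K.prod (⊤ : Subgroup ((cmDatum L 1 (Matrix.of fun i j : Fin 1 => if i.val + j.val + 1 = 1 then (1 : L) else 0)).Local v))) : Subgroup ((cmDatum L 2 (Matrix.of fun i j : Fin 2 => if i.val + j.val + 1 = 2 then (1 : L) else 0)).Local v × (cmDatum L 1 (Matrix.of fun i j : Fin 1 => if i.val + j.val + 1 = 1 then (1 : L) else 0)).Local v))) : Set ((cmDatum L 2 (Matrix.of fun i j : Fin 2 => if i.val + j.val + 1 = 2 then (1 : L) else 0)).Local v × (cmDatum L 1 (Matrix.of fun i j : Fin 1 => if i.val + j.val + 1 = 1 then (1 : L) else 0)).Local v)))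
    {u₀ v₀ : v.adicCompletion ↥(maximalRealSubfield L)} (hu : u₀ ∈ 𝒪[v.adicCompletion ↥(maximalRealSubfield L)]) (hu1 : valuation (v.adicCompletion ↥(maximalRealSubfield L)) u₀ < 1)
    (hv1 : valuation (v.adicCompletion ↥(maximalRealSubfield L)) v₀ = valuation (v.adicCompletion ↥(maximalRealSubfield L)) ϖF)
    {τE : (w.1.adicCompletion L)} (hτ : τE * τE = toPlace v w u₀ * τE + toPlace v w v₀) (hστ : (galAdicCompletionMap (L := L) (IsCMField.complexConj L) hw) τE = toPlace v w u₀ - τE)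
    (ηE : ((w.1.adicCompletion L))ˣ) (hηE : Valued.v (ηE : (w.1.adicCompletion L)) = WithZero.exp (-1 : ℤ))
    (uη : ↥(unitaryGroupOfForm (galAdicCompletionMap (L := L) (IsCMField.complexConj L) hw) (placeForm (Matrix.of fun i j : Fin 2 => if i.val + j.val + 1 = 2 then (1 : L) else 0) w.1))) (huη : (((uη : ↥(unitaryGroupOfForm (galAdicCompletionMap (L := L) (IsCMField.complexConj L) hw) (placeForm (Matrix.of fun i j : Fin 2 => if i.val + j.val + 1 = 2 then (1 : L) else 0) w.1))) : GL (Fin 2) (w.1.adicCompletion L)) : Matrix (Fin 2) (Fin 2) (w.1.adicCompletion L)) = Matrix.diagonal ![(ηE : (w.1.adicCompletion L)), ((galAdicCompletionMap (L := L) (IsCMField.complexConj L) hw) (ηE : (w.1.adicCompletion L)))⁻¹])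
    (hpos : ∀ t : ↥(Subgroup.centralizer ({t₀} : Set ((cmDatum L 2 (Matrix.of fun i j : Fin 2 => if i.val + j.val + 1 = 2 then (1 : L) else 0)).Local v × (cmDatum L 1 (Matrix.of fun i j : Fin 1 => if i.val + j.val + 1 = 1 then (1 : L) else 0)).Local v))), ∃ (s : (w.1.adicCompletion L)) (γ : GL (Fin 2) (v.adicCompletion ↥(maximalRealSubfield L))) (a b : (v.adicCompletion ↥(maximalRealSubfield L))), (γ : Matrix (Fin 2) (Fin 2) (v.adicCompletion ↥(maximalRealSubfield L))) = !![a, b * v₀; b, a + b * u₀] ∧ Matrix.diagonal ![1, α] * (((((E₂ (t : ((cmDatum L 2 (Matrix.of fun i j : Fin 2 => if i.val + j.val + 1 = 2 then (1 : L) else 0)).Local v × (cmDatum L 1 (Matrix.of fun i j : Fin 1 => if i.val + j.val + 1 = 1 then (1 : L) else 0)).Local v)).1) : ↥(unitaryGroupOfForm (galAdicCompletionMap (L := L) (IsCMField.complexConj L) hw) (placeForm (Matrix.of fun i j : Fin 2 => if i.val + j.val + 1 = 2 then (1 : L) else 0) w.1))) : GL (Fin 2) (w.1.adicCompletion L)))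 : Matrix (Fin 2) (Fin 2) (w.1.adicCompletion L)) * Matrix.diagonal ![1, α⁻¹] = s • (γ : Matrix (Fin 2) (Fin 2) (v.adicCompletion ↥(maximalRealSubfield L))).map (toPlace v w))
    -- ★-derivable from the CLOSE binders (F0P3-p01 (g15) derives it in the CLOSE: `ne_galAdicCompletionMap_of_eisenstein`)
    (hτne : τE ≠ (galAdicCompletionMap (L := L) (IsCMField.complexConj L) hw) τE) :
    ∃ (mfl j R : ℕ) (oT : ↥(Subgroup.centralizer ({t₀} : Set ((cmDatum L 2 (Matrix.of fun i j : Fin 2 => if i.val + j.val + 1 = 2 then (1 : L) else 0)).Local v × (cmDatum L 1 (Matrix.of fun i j : Fin 1 => if i.val + j.val + 1 = 1 then (1 : L) else 0)).Local v))) → ℕ) (κT : ↥(Subgroup.centralizer ({t₀} : Set ((cmDatum L 2 (Matrix.of fun i j : Fin 2 => if i.val + j.val + 1 = 2 then (1 : L) else 0)).Local v × (cmDatum L 1 (Matrix.of fun i j : Fin 1 => if i.val + j.val + 1 = 1 then (1 : L) else 0)).Local v))) → ℂ) (Φ ΦD : ℕ → ↥(Subgroup.centralizer ({t₀} : Set ((cmDatum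 L 2 (Matrix.of fun i j : Fin 2 => if i.val + j.val + 1 = 2 then (1 : L) else 0)).Local v × (cmDatum L 1 (Matrix.of fun i j : Fin 1 => if i.val + j.val + 1 = 1 then (1 : L) else 0)).Local v))) → ℂ) (Nf NDf : ℕ → ↥(Subgroup.centralizer ({t₀} : Set ((cmDatum L 2 (Matrix.of fun i j : Fin 2 => if i.val + j.val + 1 = 2 then (1 : L) else 0)).Local v × (cmDatum L 1 (Matrix.of fun i j : Fin 1 => if i.val + j.val + 1 = 1 then (1 : L) else 0)).Local v))) → ((cmDatum L 2 (Matrix.of fun i j : Fin 2 => if i.val + j.val + 1 = 2 then (1 : L) else 0)).Local v × (cmDatum L 1 (Matrix.of fun i j : Fin 1 => if i.val + j.val + 1 = 1 then (1 : L) else 0)).Local v)),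
      (∀ t : ↥(Subgroup.centralizer ({t₀} : Set ((cmDatum L 2 (Matrix.of fun i j : Fin 2 => if i.val + j.val + 1 = 2 then (1 : L) else 0)).Local v × (cmDatum L 1 (Matrix.of fun i j : Fin 1 => if i.val + j.val + 1 = 1 then (1 : L) else 0)).Local v))), t ∈ {t : ↥(Subgroup.centralizer ({t₀} : Set ((cmDatum L 2 (Matrix.of fun i j : Fin 2 => if i.val + j.val + 1 = 2 then (1 : L) else 0)).Local v × (cmDatum L 1 (Matrix.of fun i j : Fin 1 => if i.val + j.val + 1 = 1 then (1 : L) else 0)).Local v))) | IsRegularElt ((t : ((cmDatum L 2 (Matrix.of fun i j : Fin 2 => if i.val + j.val + 1 = 2 then (1 : L) else 0)).Local v × (cmDatum L 1 (Matrix.of fun i j : Fin 1 => if i.val + j.val + 1 = 1 then (1 : L) else 0)).Local v)).1.val : GL (Fin 2) (LocalRing L v))} → mfl ≤ (-WithZero.log (Valued.v ((((P⁻¹).val * ((t : ((cmDatum L 2 (Matrix.of fun i j : Fin 2 => if i.val + j.val + 1 = 2 then (1 : L) else 0)).Local v × (cmDatum L 1 (Matrix.of fun i j : Fin 1 => if i.val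 + j.val + 1 = 1 then (1 : L) else 0)).Local v)).1.val.val : Matrix (Fin 2) (Fin 2) (LocalRing L v)) * P.val) 0 0 - ((P⁻¹).val * ((t : ((cmDatum L 2 (Matrix.of fun i j : Fin 2 => if i.val + j.val + 1 = 2 then (1 : L) else 0)).Local v × (cmDatum L 1 (Matrix.of fun i j : Fin 1 => if i.val + j.val + 1 = 1 then (1 : L) else 0)).Local v)).1.val.val : Matrix (Fin 2) (Fin 2) (LocalRing L v)) * P.val) 1 1) w))).toNat → j ≤ oT t) ∧
      (∀ t : ↥(Subgroup.centralizer ({t₀} : Set ((cmDatum L 2 (Matrix.of fun i j : Fin 2 => if i.val + j.val + 1 = 2 then (1 : L) else 0)).Local v × (cmDatum L 1 (Matrix.of fun i j : Fin 1 => if i.val + j.val + 1 = 1 then (1 : L) else 0)).Local v))), t ∈ {t : ↥(Subgroup.centralizer ({t₀} : Set ((cmDatum L 2 (Matrix.of fun i j : Fin 2 => if i.val + j.val + 1 = 2 then (1 : L) else 0)).Local v × (cmDatum L 1 (Matrix.of fun i j : Fin 1 => if i.val + j.val + 1 = 1 then (1 : L) else 0)).Local v))) | IsRegularElt ((t : ((cmDatum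 L 2 (Matrix.of fun i j : Fin 2 => if i.val + j.val + 1 = 2 then (1 : L) else 0)).Local v × (cmDatum L 1 (Matrix.of fun i j : Fin 1 => if i.val + j.val + 1 = 1 then (1 : L) else 0)).Local v)).1.val : GL (Fin 2) (LocalRing L v))} → mfl ≤ (-WithZero.log (Valued.v ((((P⁻¹).val * ((t : ((cmDatum L 2 (Matrix.of fun i j : Fin 2 => if i.val + j.val + 1 = 2 then (1 : L) else 0)).Local v × (cmDatum L 1 (Matrix.of fun i j : Fin 1 => if i.val + j.val + 1 = 1 then (1 : L) else 0)).Local v)).1.val.val : Matrix (Fin 2) (Fin 2) (LocalRing L v)) * P.val) 0 0 - ((P⁻¹).val * ((t : ((cmDatum L 2 (Matrix.of fun i j : Fin 2 => if i.val + j.val + 1 = 2 then (1 : L) else 0)).Local v × (cmDatum L 1 (Matrix.of fun i j : Fin 1 => if i.val + j.val + 1 = 1 then (1 : L) else 0)).Local v)).1.val.val : Matrix (Fin 2) (Fin 2) (LocalRing L v)) * P.val) 1 1) w))).toNat → ∀ m, m + j ≤ oT t → (∫ k in (((K).prod (⊤ : Subgroup ((cmDatum L 1 (Matrix.of fun i j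 : Fin 1 => if i.val + j.val + 1 = 1 then (1 : L) else 0)).Local v)) : Subgroup ((cmDatum L 2 (Matrix.of fun i j : Fin 2 => if i.val + j.val + 1 = 2 then (1 : L) else 0)).Local v × (cmDatum L 1 (Matrix.of fun i j : Fin 1 => if i.val + j.val + 1 = 1 then (1 : L) else 0)).Local v)) : Set ((cmDatum L 2 (Matrix.of fun i j : Fin 2 => if i.val + j.val + 1 = 2 then (1 : L) else 0)).Local v × (cmDatum L 1 (Matrix.of fun i j : Fin 1 => if i.val + j.val + 1 = 1 then (1 : L) else 0)).Local v)), f (k⁻¹ * (((E₂.symm (uη⁻¹ ^ (m)), (1 : (cmDatum L 1 (Matrix.of fun i j : Fin 1 => if i.val + j.val + 1 = 1 then (1 : L) else 0)).Local v)) : ((cmDatum L 2 (Matrix.of fun i j : Fin 2 => if i.val + j.val + 1 = 2 then (1 : L) else 0)).Local v × (cmDatum L 1 (Matrix.of fun i j : Fin 1 => if i.val + j.val + 1 = 1 then (1 : L) else 0)).Local v))⁻¹ * ((t : ((cmDatum L 2 (Matrix.of fun i j : Fin 2 => if i.val + j.val + 1 = 2 then (1 : L) else 0)).Local v × (cmDatum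 L 1 (Matrix.of fun i j : Fin 1 => if i.val + j.val + 1 = 1 then (1 : L) else 0)).Local v))) * (E₂.symm (uη⁻¹ ^ (m)), 1)) * k) ∂ν) = (∫ k in (((K).prod (⊤ : Subgroup ((cmDatum L 1 (Matrix.of fun i j : Fin 1 => if i.val + j.val + 1 = 1 then (1 : L) else 0)).Local v)) : Subgroup ((cmDatum L 2 (Matrix.of fun i j : Fin 2 => if i.val + j.val + 1 = 2 then (1 : L) else 0)).Local v × (cmDatum L 1 (Matrix.of fun i j : Fin 1 => if i.val + j.val + 1 = 1 then (1 : L) else 0)).Local v)) : Set ((cmDatum L 2 (Matrix.of fun i j : Fin 2 => if i.val + j.val + 1 = 2 then (1 : L) else 0)).Local v × (cmDatum L 1 (Matrix.of fun i j : Fin 1 => if i.val + j.val + 1 = 1 then (1 : L) else 0)).Local v)), f (k⁻¹ * (((E₂.symm (uη⁻¹ ^ (m)), (1 : (cmDatum L 1 (Matrix.of fun i j : Fin 1 => if i.val + j.val + 1 = 1 then (1 : L) else 0)).Local v)) : ((cmDatum L 2 (Matrix.of fun i j : Fin 2 => if i.val + j.val + 1 = 2 then (1 : L) else 0)).Local v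 × (cmDatum L 1 (Matrix.of fun i j : Fin 1 => if i.val + j.val + 1 = 1 then (1 : L) else 0)).Local v))⁻¹ * (e (t : ((cmDatum L 2 (Matrix.of fun i j : Fin 2 => if i.val + j.val + 1 = 2 then (1 : L) else 0)).Local v × (cmDatum L 1 (Matrix.of fun i j : Fin 1 => if i.val + j.val + 1 = 1 then (1 : L) else 0)).Local v))) * (E₂.symm (uη⁻¹ ^ (m)), 1)) * k) ∂ν)) ∧
      (∀ t : ↥(Subgroup.centralizer ({t₀} : Set ((cmDatum L 2 (Matrix.of fun i j : Fin 2 => if i.val + j.val + 1 = 2 then (1 : L) else 0)).Local v × (cmDatum L 1 (Matrix.of fun i j : Fin 1 => if i.val + j.val + 1 = 1 then (1 : L) else 0)).Local v))), t ∈ {t : ↥(Subgroup.centralizer ({t₀} : Set ((cmDatum L 2 (Matrix.of fun i j : Fin 2 => if i.val + j.val + 1 = 2 then (1 : L) else 0)).Local v × (cmDatum L 1 (Matrix.of fun i j : Fin 1 => if i.val + j.val + 1 = 1 then (1 : L) else 0)).Local v))) | IsRegularElt ((t : ((cmDatum L 2 (Matrix.of fun i j : Fin 2 => if i.val + j.val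 + 1 = 2 then (1 : L) else 0)).Local v × (cmDatum L 1 (Matrix.of fun i j : Fin 1 => if i.val + j.val + 1 = 1 then (1 : L) else 0)).Local v)).1.val : GL (Fin 2) (LocalRing L v))} → mfl ≤ (-WithZero.log (Valued.v ((((P⁻¹).val * ((t : ((cmDatum L 2 (Matrix.of fun i j : Fin 2 => if i.val + j.val + 1 = 2 then (1 : L) else 0)).Local v × (cmDatum L 1 (Matrix.of fun i j : Fin 1 => if i.val + j.val + 1 = 1 then (1 : L) else 0)).Local v)).1.val.val : Matrix (Fin 2) (Fin 2) (LocalRing L v)) * P.val) 0 0 - ((P⁻¹).val * ((t : ((cmDatum L 2 (Matrix.of fun i j : Fin 2 => if i.val + j.val + 1 = 2 then (1 : L) else 0)).Local v × (cmDatum L 1 (Matrix.of fun i j : Fin 1 => if i.val + j.val + 1 = 1 then (1 : L) else 0)).Local v)).1.val.val : Matrix (Fin 2) (Fin 2) (LocalRing L v)) * P.val) 1 1) w))).toNat → ∀ i ∈ Finset.range (j + R + 1), (∫ k in (((K).prod (⊤ : Subgroup ((cmDatum L 1 (Matrix.of fun i j : Fin 1 => if i.val + j.val + 1 = 1 then (1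 : L) else 0)).Local v)) : Subgroup ((cmDatum L 2 (Matrix.of fun i j : Fin 2 => if i.val + j.val + 1 = 2 then (1 : L) else 0)).Local v × (cmDatum L 1 (Matrix.of fun i j : Fin 1 => if i.val + j.val + 1 = 1 then (1 : L) else 0)).Local v)) : Set ((cmDatum L 2 (Matrix.of fun i j : Fin 2 => if i.val + j.val + 1 = 2 then (1 : L) else 0)).Local v × (cmDatum L 1 (Matrix.of fun i j : Fin 1 => if i.val + j.val + 1 = 1 then (1 : L) else 0)).Local v)), f (k⁻¹ * (((E₂.symm (uη⁻¹ ^ (oT t - j + i)), (1 : (cmDatum L 1 (Matrix.of fun i j : Fin 1 => if i.val + j.val + 1 = 1 then (1 : L) else 0)).Local v)) : ((cmDatum L 2 (Matrix.of fun i j : Fin 2 => if i.val + j.val + 1 = 2 then (1 : L) else 0)).Local v × (cmDatum L 1 (Matrix.of fun i j : Fin 1 => if i.val + j.val + 1 = 1 then (1 : L) else 0)).Local v))⁻¹ * ((t : ((cmDatum L 2 (Matrix.of fun i j : Fin 2 => if i.val + j.val + 1 = 2 then (1 : L) else 0)).Local v × (cmDatum L 1 (Matrix.of fun i j : Fin 1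 => if i.val + j.val + 1 = 1 then (1 : L) else 0)).Local v))) * (E₂.symm (uη⁻¹ ^ (oT t - j + i)), 1)) * k) ∂ν) - (∫ k in (((K).prod (⊤ : Subgroup ((cmDatum L 1 (Matrix.of fun i j : Fin 1 => if i.val + j.val + 1 = 1 then (1 : L) else 0)).Local v)) : Subgroup ((cmDatum L 2 (Matrix.of fun i j : Fin 2 => if i.val + j.val + 1 = 2 then (1 : L) else 0)).Local v × (cmDatum L 1 (Matrix.of fun i j : Fin 1 => if i.val + j.val + 1 = 1 then (1 : L) else 0)).Local v)) : Set ((cmDatum L 2 (Matrix.of fun i j : Fin 2 => if i.val + j.val + 1 = 2 then (1 : L) else 0)).Local v × (cmDatum L 1 (Matrix.of fun i j : Fin 1 => if i.val + j.val + 1 = 1 then (1 : L) else 0)).Local v)), f (k⁻¹ * (((E₂.symm (uη⁻¹ ^ (oT t - j + i)), (1 : (cmDatum L 1 (Matrix.of fun i j : Fin 1 => if i.val + j.val + 1 = 1 then (1 : L) else 0)).Local v)) : ((cmDatum L 2 (Matrix.of fun i j : Fin 2 => if i.val + j.val + 1 = 2 then (1 : L) else 0)).Local v × (cmDatum L 1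 (Matrix.of fun i j : Fin 1 => if i.val + j.val + 1 = 1 then (1 : L) else 0)).Local v))⁻¹ * (e (t : ((cmDatum L 2 (Matrix.of fun i j : Fin 2 => if i.val + j.val + 1 = 2 then (1 : L) else 0)).Local v × (cmDatum L 1 (Matrix.of fun i j : Fin 1 => if i.val + j.val + 1 = 1 then (1 : L) else 0)).Local v))) * (E₂.symm (uη⁻¹ ^ (oT t - j + i)), 1)) * k) ∂ν) = κT t * (Φ i t - ΦD i t)) ∧
      (∀ t : ↥(Subgroup.centralizer ({t₀} : Set ((cmDatum L 2 (Matrix.of fun i j : Fin 2 => if i.val + j.val + 1 = 2 then (1 : L) else 0)).Local v × (cmDatum L 1 (Matrix.of fun i j : Fin 1 => if i.val + j.val + 1 = 1 then (1 : L) else 0)).Local v))), t ∈ {t : ↥(Subgroup.centralizer ({t₀} : Set ((cmDatum L 2 (Matrix.of fun i j : Fin 2 => if i.val + j.val + 1 = 2 then (1 : L) else 0)).Local v × (cmDatum L 1 (Matrix.of fun i j : Fin 1 => if i.val + j.val + 1 = 1 then (1 : L) else 0)).Local v))) | IsRegularElt ((t : ((cmDatum L 2 (Matrix.of fun i j : Fin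 2 => if i.val + j.val + 1 = 2 then (1 : L) else 0)).Local v × (cmDatum L 1 (Matrix.of fun i j : Fin 1 => if i.val + j.val + 1 = 1 then (1 : L) else 0)).Local v)).1.val : GL (Fin 2) (LocalRing L v))} → mfl ≤ (-WithZero.log (Valued.v ((((P⁻¹).val * ((t : ((cmDatum L 2 (Matrix.of fun i j : Fin 2 => if i.val + j.val + 1 = 2 then (1 : L) else 0)).Local v × (cmDatum L 1 (Matrix.of fun i j : Fin 1 => if i.val + j.val + 1 = 1 then (1 : L) else 0)).Local v)).1.val.val : Matrix (Fin 2) (Fin 2) (LocalRing L v)) * P.val) 0 0 - ((P⁻¹).val * ((t : ((cmDatum L 2 (Matrix.of fun i j : Fin 2 => if i.val + j.val + 1 = 2 then (1 : L) else 0)).Local v × (cmDatum L 1 (Matrix.of fun i j : Fin 1 => if i.val + j.val + 1 = 1 then (1 : L) else 0)).Local v)).1.val.val : Matrix (Fin 2) (Fin 2) (LocalRing L v)) * P.val) 1 1) w))).toNat → ∀ m, oT t + R < m → (∫ k in (((K).prod (⊤ : Subgroup ((cmDatum L 1 (Matrix.of fun i j : Fin 1 => if i.val + j.val + 1 = 1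 then (1 : L) else 0)).Local v)) : Subgroup ((cmDatum L 2 (Matrix.of fun i j : Fin 2 => if i.val + j.val + 1 = 2 then (1 : L) else 0)).Local v × (cmDatum L 1 (Matrix.of fun i j : Fin 1 => if i.val + j.val + 1 = 1 then (1 : L) else 0)).Local v)) : Set ((cmDatum L 2 (Matrix.of fun i j : Fin 2 => if i.val + j.val + 1 = 2 then (1 : L) else 0)).Local v × (cmDatum L 1 (Matrix.of fun i j : Fin 1 => if i.val + j.val + 1 = 1 then (1 : L) else 0)).Local v)), f (k⁻¹ * (((E₂.symm (uη⁻¹ ^ (m)), (1 : (cmDatum L 1 (Matrix.of fun i j : Fin 1 => if i.val + j.val + 1 = 1 then (1 : L) else 0)).Local v)) : ((cmDatum L 2 (Matrix.of fun i j : Fin 2 => if i.val + j.val + 1 = 2 then (1 : L) else 0)).Local v × (cmDatum L 1 (Matrix.of fun i j : Fin 1 => if i.val + j.val + 1 = 1 then (1 : L) else 0)).Local v))⁻¹ * ((t : ((cmDatum L 2 (Matrix.of fun i j : Fin 2 => if i.val + j.val + 1 = 2 then (1 : L) else 0)).Local v × (cmDatum L 1 (Matrix.of fun i j : Fin 1 =>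 if i.val + j.val + 1 = 1 then (1 : L) else 0)).Local v))) * (E₂.symm (uη⁻¹ ^ (m)), 1)) * k) ∂ν) = 0 ∧ (∫ k in (((K).prod (⊤ : Subgroup ((cmDatum L 1 (Matrix.of fun i j : Fin 1 => if i.val + j.val + 1 = 1 then (1 : L) else 0)).Local v)) : Subgroup ((cmDatum L 2 (Matrix.of fun i j : Fin 2 => if i.val + j.val + 1 = 2 then (1 : L) else 0)).Local v × (cmDatum L 1 (Matrix.of fun i j : Fin 1 => if i.val + j.val + 1 = 1 then (1 : L) else 0)).Local v)) : Set ((cmDatum L 2 (Matrix.of fun i j : Fin 2 => if i.val + j.val + 1 = 2 then (1 : L) else 0)).Local v × (cmDatum L 1 (Matrix.of fun i j : Fin 1 => if i.val + j.val + 1 = 1 then (1 : L) else 0)).Local v)), f (k⁻¹ * (((E₂.symm (uη⁻¹ ^ (m)), (1 : (cmDatum L 1 (Matrix.of fun i j : Fin 1 => if i.val + j.val + 1 = 1 then (1 : L) else 0)).Local v)) : ((cmDatum L 2 (Matrix.of fun i j : Fin 2 => if i.val + j.val + 1 = 2 then (1 : L) else 0)).Local v × (cmDatum L 1 (Matrix.of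 fun i j : Fin 1 => if i.val + j.val + 1 = 1 then (1 : L) else 0)).Local v))⁻¹ * (e (t : ((cmDatum L 2 (Matrix.of fun i j : Fin 2 => if i.val + j.val + 1 = 2 then (1 : L) else 0)).Local v × (cmDatum L 1 (Matrix.of fun i j : Fin 1 => if i.val + j.val + 1 = 1 then (1 : L) else 0)).Local v))) * (E₂.symm (uη⁻¹ ^ (m)), 1)) * k) ∂ν) = 0) ∧
      (∀ i t, Φ i t = ∫ k in (((K).prod (⊤ : Subgroup ((cmDatum L 1 (Matrix.of fun i j : Fin 1 => if i.val + j.val + 1 = 1 then (1 : L) else 0)).Local v)) : Subgroup ((cmDatum L 2 (Matrix.of fun i j : Fin 2 => if i.val + j.val + 1 = 2 then (1 : L) else 0)).Local v × (cmDatum L 1 (Matrix.of fun i j : Fin 1 => if i.val + j.val + 1 = 1 then (1 : L) else 0)).Local v)) : Set ((cmDatum L 2 (Matrix.of fun i j : Fin 2 => if i.val + j.val + 1 = 2 then (1 : L) else 0)).Local v × (cmDatum L 1 (Matrix.of fun i j : Fin 1 => if i.val + j.val + 1 = 1 then (1 : L) else 0)).Local v)), f (k⁻¹ * Nf i t * k)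 ∂ν) ∧ (∀ i t, ΦD i t = ∫ k in (((K).prod (⊤ : Subgroup ((cmDatum L 1 (Matrix.of fun i j : Fin 1 => if i.val + j.val + 1 = 1 then (1 : L) else 0)).Local v)) : Subgroup ((cmDatum L 2 (Matrix.of fun i j : Fin 2 => if i.val + j.val + 1 = 2 then (1 : L) else 0)).Local v × (cmDatum L 1 (Matrix.of fun i j : Fin 1 => if i.val + j.val + 1 = 1 then (1 : L) else 0)).Local v)) : Set ((cmDatum L 2 (Matrix.of fun i j : Fin 2 => if i.val + j.val + 1 = 2 then (1 : L) else 0)).Local v × (cmDatum L 1 (Matrix.of fun i j : Fin 1 => if i.val + j.val + 1 = 1 then (1 : L) else 0)).Local v)), f (k⁻¹ * NDf i t * k) ∂ν) ∧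
      (∀ i ∈ Finset.range (j + R + 1), ∀ s : ↥(Subgroup.centralizer ({t₀} : Set ((cmDatum L 2 (Matrix.of fun i j : Fin 2 => if i.val + j.val + 1 = 2 then (1 : L) else 0)).Local v × (cmDatum L 1 (Matrix.of fun i j : Fin 1 => if i.val + j.val + 1 = 1 then (1 : L) else 0)).Local v))), ¬ IsRegularElt ((s : ((cmDatum L 2 (Matrix.of fun i j : Fin 2 => if i.val + j.val + 1 = 2 then (1 : L) else 0)).Local v × (cmDatum L 1 (Matrix.of fun i j : Fin 1 => if i.val + j.val + 1 = 1 then (1 : L) else 0)).Local v)).1.val : GL (Fin 2) (LocalRing L v)) → ContinuousAt (Nf i) s ∧ ContinuousAt (NDf i) s) ∧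
      (∀ t : ↥(Subgroup.centralizer ({t₀} : Set ((cmDatum L 2 (Matrix.of fun i j : Fin 2 => if i.val + j.val + 1 = 2 then (1 : L) else 0)).Local v × (cmDatum L 1 (Matrix.of fun i j : Fin 1 => if i.val + j.val + 1 = 1 then (1 : L) else 0)).Local v))), t ∈ {t : ↥(Subgroup.centralizer ({t₀} : Set ((cmDatum L 2 (Matrix.of fun i j : Fin 2 => if i.val + j.val + 1 = 2 then (1 : L) else 0)).Local v × (cmDatum L 1 (Matrix.of fun i j : Fin 1 => if i.val + j.val + 1 = 1 then (1 : L) else 0)).Local v))) | IsRegularElt ((t : ((cmDatum L 2 (Matrix.of fun i j : Fin 2 => if i.val + j.val + 1 = 2 then (1 : L) else 0)).Local v × (cmDatum L 1 (Matrix.of fun i j : Fin 1 => if i.val + j.val + 1 = 1 then (1 : L) else 0)).Local v)).1.val : GL (Fin 2) (LocalRing L v))} → mfl ≤ (-WithZero.log (Valued.v ((((P⁻¹).val * ((t : ((cmDatum L 2 (Matrix.of fun i j : Fin 2 => if i.val + j.val + 1 = 2 then (1 : L) else 0)).Local v × (cmDatum L 1 (Matrix.of fun i j : Fin 1 => if i.val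 + j.val + 1 = 1 then (1 : L) else 0)).Local v)).1.val.val : Matrix (Fin 2) (Fin 2) (LocalRing L v)) * P.val) 0 0 - ((P⁻¹).val * ((t : ((cmDatum L 2 (Matrix.of fun i j : Fin 2 => if i.val + j.val + 1 = 2 then (1 : L) else 0)).Local v × (cmDatum L 1 (Matrix.of fun i j : Fin 1 => if i.val + j.val + 1 = 1 then (1 : L) else 0)).Local v)).1.val.val : Matrix (Fin 2) (Fin 2) (LocalRing L v)) * P.val) 1 1) w))).toNat →
      ∃ βF : (v.adicCompletion ↥(maximalRealSubfield L)), toPlace v w βF = α * ((((E₂ (t : ((cmDatum L 2 (Matrix.of fun i j : Fin 2 => if i.val + j.val + 1 = 2 then (1 : L) else 0)).Local v × (cmDatum L 1 (Matrix.of fun i j : Fin 1 => if i.val + j.val + 1 = 1 then (1 : L) else 0)).Local v)).1 : ↥(unitaryGroupOfForm (galAdicCompletionMap (L := L) (IsCMField.complexConj L) hw) (placeForm (Matrix.of fun i j : Fin 2 => if i.val + j.val + 1 = 2 then (1 : L) else 0) w.1))) : GL (Fin 2) (w.1.adicCompletion L)) : Matrix (Fin 2) (Fin 2) (w.1.adicCompletion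 L))) 1 0 / ((((E₂ (t : ((cmDatum L 2 (Matrix.of fun i j : Fin 2 => if i.val + j.val + 1 = 2 then (1 : L) else 0)).Local v × (cmDatum L 1 (Matrix.of fun i j : Fin 1 => if i.val + j.val + 1 = 1 then (1 : L) else 0)).Local v)).1 : ↥(unitaryGroupOfForm (galAdicCompletionMap (L := L) (IsCMField.complexConj L) hw) (placeForm (Matrix.of fun i j : Fin 2 => if i.val + j.val + 1 = 2 then (1 : L) else 0) w.1))) : GL (Fin 2) (w.1.adicCompletion L)) : Matrix (Fin 2) (Fin 2) (w.1.adicCompletion L))) 0 0 ∧ Valued.v βF = WithZero.exp (-(oT t : ℤ)) ∧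
        κT t = ((hilbertSymbol (v.adicCompletion ↥(maximalRealSubfield L)) βF (algebraMap ↥(maximalRealSubfield L) _ ((cmQuadraticGenerator L : 𝓞 ↥(maximalRealSubfield L)) : ↥(maximalRealSubfield L))) : ℤ) : ℂ)) := by
  classical
  haveI hDVR : IsDiscreteValuationRing 𝒪[(v.adicCompletion ↥(maximalRealSubfield L))] := isDiscreteValuationRing_integer_of_compatible hϖF
  have hc1 : IsCMField.complexConj L ≠ 1 := IsCMField.complexConj_ne_one L
  /- §0a the Eisenstein pair `(τE, σ_w τE)` -/
  have hσσ : ∀ z : (w.1.adicCompletion L), (galAdicCompletionMap (L := L) (IsCMField.complexConj L) hw) ((galAdicCompletionMap (L := L) (IsCMField.complexConj L) hw) z) = z := fun z => galAdicCompletionMap_complexConj_self L v w hw z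
  have hsum : τE + (galAdicCompletionMap (L := L) (IsCMField.complexConj L) hw) τE = toPlace v w u₀ := by rw [hστ]; ring
  have hprod : τE * (galAdicCompletionMap (L := L) (IsCMField.complexConj L) hw) τE = -(toPlace v w v₀) := by rw [hστ]; linear_combination -hτ
  have hsum' : (galAdicCompletionMap (L := L) (IsCMField.complexConj L) hw) τE + (galAdicCompletionMap (L := L) (IsCMField.complexConj L) hw) ((galAdicCompletionMap (L := L) (IsCMField.complexConj L) hw) τE) = toPlace v w u₀ := by rw [hσσ, add_comm]; exact hsum
  have hprod' : (galAdicCompletionMap (L := L) (IsCMField.complexConj L) hw) τE * (galAdicCompletionMap (L := L) (IsCMField.complexConj L) hw) ((galAdicCompletionMap (L := L) (IsCMField.complexConj L) hw) τE) = -(toPlace v w v₀) := by rw [hσσ, mul_comm]; exact hprod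
  have hτd0 : τE - (galAdicCompletionMap (L := L) (IsCMField.complexConj L) hw) τE ≠ 0 := sub_ne_zero.2 hτne
  have hστ0 : (galAdicCompletionMap (L := L) (IsCMField.complexConj L) hw) τE ≠ 0 := by
    intro h0
    have hz : τE = 0 := by rw [← hσσ τE, h0, map_zero]
    exact hτne (by rw [hz, map_zero])
  have hvστ : Valued.v τE = Valued.v ((galAdicCompletionMap (L := L) (IsCMField.complexConj L) hw) τE) := by rw [valued_galAdicCompletionMap]
  have hσι : ∀ x : (v.adicCompletion ↥(maximalRealSubfield L)), (galAdicCompletionMap (L := L) (IsCMField.complexConj L) hw) (toPlace v w x) = toPlace v w x := fun x => galAdicCompletionMap_toPlace_self L v w hw x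
  have hιcont : Continuous (toPlace (E := L) v w) := (isClosedEmbedding_toPlace L v w).continuous
  /- §0b the non-norm unit `uF` with `ι uF = u`, `(uF, θ)_v = −1` -/
  obtain ⟨uF, huF⟩ := exists_toPlace_eq_of_galAdicCompletionMap_eq (IsCMField.complexConj L) w hc1 hw (u : (w.1.adicCompletion L)) hσu
  have hu0 : (u : (w.1.adicCompletion L)) ≠ 0 := u.ne_zero
  have huF0 : uF ≠ 0 := by
    intro h; apply hu0; rw [← huF, h, map_zero]
  have huFv : Valued.v uF = 1 := by
    have h := valued_toPlace_eq_sq_of_ramified L v w hw he uF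
    rw [huF, hvu] at h
    have hv0 : Valued.v uF ≠ 0 := (Valuation.ne_zero_iff _).2 huF0
    obtain ⟨k, hk⟩ : ∃ k : ℤ, Valued.v uF = WithZero.exp k := ⟨WithZero.log (Valued.v uF), (WithZero.exp_log hv0).symm⟩
    rw [hk, ← WithZero.exp_nsmul, ← WithZero.exp_zero] at h
    have h2 := WithZero.exp_injective h
    rw [hk, ← WithZero.exp_zero]
    congr 1
    simp only [nsmul_eq_mul, Nat.cast_ofNat] at h2
    exact int_eq_of_two_mul_eq_two_mul (c := 0) (by rw [mul_zero]; exact h2.symm)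
  have huF1 : valuation (v.adicCompletion ↥(maximalRealSubfield L)) uF = 1 := (v_eq_one_iff_valuation_eq_one uF).1 huFv
  have hunF : ¬ ∃ z : (w.1.adicCompletion L), toPlace v w uF = (galAdicCompletionMap (L := L) (IsCMField.complexConj L) hw) z * z := by rw [huF]; exact hun
  have huθ : hilbertSymbol (v.adicCompletion ↥(maximalRealSubfield L)) uF (algebraMap ↥(maximalRealSubfield L) (v.adicCompletion ↥(maximalRealSubfield L)) ((cmQuadraticGenerator L : 𝓞 ↥(maximalRealSubfield L)) : ↥(maximalRealSubfield L))) = -1 := hilbertSymbol_eq_neg_one_of_not_exists_norm L v w hw huF0 hunF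
  have huu : (u : (w.1.adicCompletion L)) = toPlace v w uF := huF.symm
  /- §0c the norm `c = N(ηE)`, a uniformiser of `L⁺_v` -/
  have hηE0 : (ηE : (w.1.adicCompletion L)) ≠ 0 := ηE.ne_zero
  have hfixc : (galAdicCompletionMap (L := L) (IsCMField.complexConj L) hw) ((ηE : (w.1.adicCompletion L)) * (galAdicCompletionMap (L := L) (IsCMField.complexConj L) hw) (ηE : (w.1.adicCompletion L))) = (ηE : (w.1.adicCompletion L)) * (galAdicCompletionMap (L := L) (IsCMField.complexConj L) hw) (ηE : (w.1.adicCompletion L)) := by rw [map_mul, hσσ, mul_comm]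
  obtain ⟨c, hc⟩ := exists_toPlace_eq_of_galAdicCompletionMap_eq (IsCMField.complexConj L) w hc1 hw _ hfixc
  have hc0 : c ≠ 0 := by
    intro h
    rw [h, map_zero] at hc
    rcases mul_eq_zero.1 hc.symm with h1 | h1
    · exact hηE0 h1
    · exact hηE0 (by rw [← hσσ (ηE : (w.1.adicCompletion L)), h1, map_zero])
  have hvc : Valued.v c = WithZero.exp (-1 : ℤ) := by
    have h2 : Valued.v (toPlace v w c) = WithZero.exp (-1 : ℤ) ^ 2 := by
      rw [hc, map_mul, valued_galAdicCompletionMap, hηE, pow_two]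
    rw [valued_toPlace_eq_sq_of_ramified L v w hw he c] at h2
    have hv0 : Valued.v c ≠ 0 := (Valuation.ne_zero_iff _).2 hc0
    obtain ⟨k, hk⟩ : ∃ k : ℤ, Valued.v c = WithZero.exp k := ⟨WithZero.log (Valued.v c), (WithZero.exp_log hv0).symm⟩
    rw [hk, ← WithZero.exp_nsmul, ← WithZero.exp_nsmul] at h2
    have h3 := WithZero.exp_injective h2
    rw [hk]
    congr 1
    simp only [nsmul_eq_mul, Nat.cast_ofNat] at h3
    exact int_eq_of_two_mul_eq_two_mul h3
  have hcπ : valuation (v.adicCompletion ↥(maximalRealSubfield L)) c = valuation (v.adicCompletion ↥(maximalRealSubfield L)) ϖF := (v_eq_iff_valuation_eq c ϖF).1 (by rw [hvc, hϖF])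
  have hvcj : ∀ n : ℕ, Valued.v c ^ n = WithZero.exp (-(n : ℤ)) := by
    intro n; rw [hvc, ← WithZero.exp_nsmul]; congr 1; simp
  /- §0d integrality of the datum -/
  have hu' : Valued.v u₀ ≤ 1 := (v_le_one_iff_mem_integer u₀).2 hu
  have hv' : Valued.v v₀ ≤ 1 := by
    rw [(v_eq_iff_valuation_eq v₀ ϖF).2 hv1, hϖF, ← WithZero.exp_zero]; exact WithZero.exp_le_exp.2 (by norm_num)
  /- §0e the frame `Pw := P_w`, `d := diag(1, α)` -/
  set Pw : GL (Fin 2) (w.1.adicCompletion L) := Matrix.GeneralLinearGroup.map (Pi.evalRingHom (fun w' : PlacesOver L v => w'.1.adicCompletion L) w) P with hPwdef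
  have hQu : IsUnit (Pw : Matrix (Fin 2) (Fin 2) (w.1.adicCompletion L)).det := (Matrix.isUnit_iff_isUnit_det _).1 Pw.isUnit
  have hDD : Matrix.diagonal ![(1 : (w.1.adicCompletion L)), α⁻¹] * Matrix.diagonal ![1, α] = 1 := by
    rw [Matrix.diagonal_mul_diagonal, ← Matrix.diagonal_one]; congr 1; ext i; fin_cases i <;> simp [inv_mul_cancel₀ hα0]
  have hDu : IsUnit (Matrix.diagonal ![(1 : (w.1.adicCompletion L)), α]).det := by
    rw [Matrix.det_diagonal, Fin.prod_univ_two]; simp [hα0]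
  have hframe : ∀ t : ↥(Subgroup.centralizer ({t₀} : Set ((cmDatum L 2 (Matrix.of fun i j : Fin 2 => if i.val + j.val + 1 = 2 then (1 : L) else 0)).Local v × (cmDatum L 1 (Matrix.of fun i j : Fin 1 => if i.val + j.val + 1 = 1 then (1 : L) else 0)).Local v))), ((((E₂ (t : ((cmDatum L 2 (Matrix.of fun i j : Fin 2 => if i.val + j.val + 1 = 2 then (1 : L) else 0)).Local v × (cmDatum L 1 (Matrix.of fun i j : Fin 1 => if i.val + j.val + 1 = 1 then (1 : L) else 0)).Local v)).1 : ↥(unitaryGroupOfForm (galAdicCompletionMap (L := L) (IsCMField.complexConj L) hw) (placeForm (Matrix.of fun i j : Fin 2 => if i.val + j.val + 1 = 2 then (1 : L) else 0) w.1))) : GL (Fin 2) (w.1.adicCompletion L)) : Matrix (Fin 2) (Fin 2) (w.1.adicCompletion L))) * (Pw : Matrix (Fin 2) (Fin 2) (w.1.adicCompletion L)) = (Pw : Matrix (Fin 2) (Fin 2) (w.1.adicCompletion L)) * Matrix.diagonal ![((P⁻¹).val * ((t : ((cmDatum L 2 (Matrix.of fun i j : Fin 2 => if i.val + j.val + 1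 = 2 then (1 : L) else 0)).Local v × (cmDatum L 1 (Matrix.of fun i j : Fin 1 => if i.val + j.val + 1 = 1 then (1 : L) else 0)).Local v)).1.val.val : Matrix (Fin 2) (Fin 2) (LocalRing L v)) * P.val) 0 0 w, ((P⁻¹).val * ((t : ((cmDatum L 2 (Matrix.of fun i j : Fin 2 => if i.val + j.val + 1 = 2 then (1 : L) else 0)).Local v × (cmDatum L 1 (Matrix.of fun i j : Fin 1 => if i.val + j.val + 1 = 1 then (1 : L) else 0)).Local v)).1.val.val : Matrix (Fin 2) (Fin 2) (LocalRing L v)) * P.val) 1 1 w] := by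
    intro t
    have hPt := frame_of_mem_centralizer L v w hw t₀ P d ht₀ hP hd1 t
    have hTt := coe_localNonsplitEquiv_mul_map_eq L v w hw (t : ((cmDatum L 2 (Matrix.of fun i j : Fin 2 => if i.val + j.val + 1 = 2 then (1 : L) else 0)).Local v × (cmDatum L 1 (Matrix.of fun i j : Fin 1 => if i.val + j.val + 1 = 1 then (1 : L) else 0)).Local v)).1 P _ hPt
    rw [← hE₂, ← hPwdef, Matrix.diagonal_map (map_zero _)] at hTt
    have hdτ : (Matrix.diagonal fun i => Pi.evalRingHom (fun w' : PlacesOver L v => w'.1.adicCompletion L) w (![((P⁻¹).val * ((t : ((cmDatum L 2 (Matrix.of fun i j : Fin 2 => if i.val + j.val + 1 = 2 then (1 : L) else 0)).Local v × (cmDatum L 1 (Matrix.of fun i j : Fin 1 => if i.val + j.val + 1 = 1 then (1 : L) else 0)).Local v)).1.val.val : Matrix (Fin 2) (Fin 2) (LocalRing L v)) * P.val) 0 0, ((P⁻¹).val * ((t : ((cmDatum L 2 (Matrix.of fun i j : Fin 2 => if i.val + j.val + 1 = 2 then (1 : L) else 0)).Local v × (cmDatum L 1 (Matrix.of fun i j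 : Fin 1 => if i.val + j.val + 1 = 1 then (1 : L) else 0)).Local v)).1.val.val : Matrix (Fin 2) (Fin 2) (LocalRing L v)) * P.val) 1 1] i)) = Matrix.diagonal ![((P⁻¹).val * ((t : ((cmDatum L 2 (Matrix.of fun i j : Fin 2 => if i.val + j.val + 1 = 2 then (1 : L) else 0)).Local v × (cmDatum L 1 (Matrix.of fun i j : Fin 1 => if i.val + j.val + 1 = 1 then (1 : L) else 0)).Local v)).1.val.val : Matrix (Fin 2) (Fin 2) (LocalRing L v)) * P.val) 0 0 w, ((P⁻¹).val * ((t : ((cmDatum L 2 (Matrix.of fun i j : Fin 2 => if i.val + j.val + 1 = 2 then (1 : L) else 0)).Local v × (cmDatum L 1 (Matrix.of fun i j : Fin 1 => if i.val + j.val + 1 = 1 then (1 : L) else 0)).Local v)).1.val.val : Matrix (Fin 2) (Fin 2) (LocalRing L v)) * P.val) 1 1 w] := by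
      congr 1; funext i; fin_cases i <;> rfl
    rw [hdτ] at hTt
    exact hTt
  have hv1' : ∀ t : ↥(Subgroup.centralizer ({t₀} : Set ((cmDatum L 2 (Matrix.of fun i j : Fin 2 => if i.val + j.val + 1 = 2 then (1 : L) else 0)).Local v × (cmDatum L 1 (Matrix.of fun i j : Fin 1 => if i.val + j.val + 1 = 1 then (1 : L) else 0)).Local v))), Valued.v (((P⁻¹).val * ((t : ((cmDatum L 2 (Matrix.of fun i j : Fin 2 => if i.val + j.val + 1 = 2 then (1 : L) else 0)).Local v × (cmDatum L 1 (Matrix.of fun i j : Fin 1 => if i.val + j.val + 1 = 1 then (1 : L) else 0)).Local v)).1.val.val : Matrix (Fin 2) (Fin 2) (LocalRing L v)) * P.val) 1 1 w) = 1 := fun t =>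
    valued_apply_eq_one_of_conjLocal_mul_self L v w hw (conjLocal_frameEntry_mul_self_apply L v w hw t₀ P d ht₀ hP hd1 t 1)
  have hv0' : ∀ t : ↥(Subgroup.centralizer ({t₀} : Set ((cmDatum L 2 (Matrix.of fun i j : Fin 2 => if i.val + j.val + 1 = 2 then (1 : L) else 0)).Local v × (cmDatum L 1 (Matrix.of fun i j : Fin 1 => if i.val + j.val + 1 = 1 then (1 : L) else 0)).Local v))), Valued.v (((P⁻¹).val * ((t : ((cmDatum L 2 (Matrix.of fun i j : Fin 2 => if i.val + j.val + 1 = 2 then (1 : L) else 0)).Local v × (cmDatum L 1 (Matrix.of fun i j : Fin 1 => if i.val + j.val + 1 = 1 then (1 : L) else 0)).Local v)).1.val.val : Matrix (Fin 2) (Fin 2) (LocalRing L v)) * P.val) 0 0 w) = 1 := fun t =>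
    valued_apply_eq_one_of_conjLocal_mul_self L v w hw (conjLocal_frameEntry_mul_self_apply L v w hw t₀ P d ht₀ hP hd1 t 0)
  /- §1 descent data along the torus (standard position, per `t`) -/
  choose sF γF aF bF hγF hGF using hpos
  have hG : ∀ t : ↥(Subgroup.centralizer ({t₀} : Set ((cmDatum L 2 (Matrix.of fun i j : Fin 2 => if i.val + j.val + 1 = 2 then (1 : L) else 0)).Local v × (cmDatum L 1 (Matrix.of fun i j : Fin 1 => if i.val + j.val + 1 = 1 then (1 : L) else 0)).Local v))), Matrix.diagonal ![1, α] * ((((E₂ (t : ((cmDatum L 2 (Matrix.of fun i j : Fin 2 => if i.val + j.val + 1 = 2 then (1 : L) else 0)).Local v × (cmDatum L 1 (Matrix.of fun i j : Fin 1 => if i.val + j.val + 1 = 1 then (1 : L) else 0)).Local v)).1 : ↥(unitaryGroupOfForm (galAdicCompletionMap (L := L) (IsCMField.complexConj L) hw) (placeForm (Matrix.of fun i j : Fin 2 => if i.val + j.val + 1 = 2 then (1 : L) else 0) w.1))) : GL (Fin 2) (w.1.adicCompletion L)) : Matrix (Fin 2) (Fin 2) (w.1.adicCompletion L))) * Matrix.diagonal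 ![1, α⁻¹] = sF t • (!![aF t, bF t * v₀; bF t, aF t + bF t * u₀]).map (toPlace v w) := by
    intro t; rw [← hγF t]; exact hGF t
  have h00 : ∀ t : ↥(Subgroup.centralizer ({t₀} : Set ((cmDatum L 2 (Matrix.of fun i j : Fin 2 => if i.val + j.val + 1 = 2 then (1 : L) else 0)).Local v × (cmDatum L 1 (Matrix.of fun i j : Fin 1 => if i.val + j.val + 1 = 1 then (1 : L) else 0)).Local v))), ((((E₂ (t : ((cmDatum L 2 (Matrix.of fun i j : Fin 2 => if i.val + j.val + 1 = 2 then (1 : L) else 0)).Local v × (cmDatum L 1 (Matrix.of fun i j : Fin 1 => if i.val + j.val + 1 = 1 then (1 : L) else 0)).Local v)).1 : ↥(unitaryGroupOfForm (galAdicCompletionMap (L := L) (IsCMField.complexConj L) hw) (placeForm (Matrix.of fun i j : Fin 2 => if i.val + j.val + 1 = 2 then (1 : L) else 0) w.1))) : GL (Fin 2) (w.1.adicCompletion L)) : Matrix (Fin 2) (Fin 2) (w.1.adicCompletion L))) 0 0 = sF t * toPlace v w (aF t) := fun t => (descent_entries (toPlace v w) (hG t)).1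
  -- the `a = 1` normal form wherever `X₀₀ ≠ 0`
  have hsa : ∀ t : ↥(Subgroup.centralizer ({t₀} : Set ((cmDatum L 2 (Matrix.of fun i j : Fin 2 => if i.val + j.val + 1 = 2 then (1 : L) else 0)).Local v × (cmDatum L 1 (Matrix.of fun i j : Fin 1 => if i.val + j.val + 1 = 1 then (1 : L) else 0)).Local v))), ((((E₂ (t : ((cmDatum L 2 (Matrix.of fun i j : Fin 2 => if i.val + j.val + 1 = 2 then (1 : L) else 0)).Local v × (cmDatum L 1 (Matrix.of fun i j : Fin 1 => if i.val + j.val + 1 = 1 then (1 : L) else 0)).Local v)).1 : ↥(unitaryGroupOfForm (galAdicCompletionMap (L := L) (IsCMField.complexConj L) hw) (placeForm (Matrix.of fun i j : Fin 2 => if i.val + j.val + 1 = 2 then (1 : L) else 0) w.1))) : GL (Fin 2) (w.1.adicCompletion L)) : Matrix (Fin 2) (Fin 2) (w.1.adicCompletion L))) 0 0 ≠ 0 → sF t ≠ 0 ∧ aF t ≠ 0 := by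
    intro t h; rw [h00 t] at h
    exact ⟨left_ne_zero_of_mul h, fun ha => (right_ne_zero_of_mul h) (by rw [ha, map_zero])⟩
  have hN1 : ∀ t : ↥(Subgroup.centralizer ({t₀} : Set ((cmDatum L 2 (Matrix.of fun i j : Fin 2 => if i.val + j.val + 1 = 2 then (1 : L) else 0)).Local v × (cmDatum L 1 (Matrix.of fun i j : Fin 1 => if i.val + j.val + 1 = 1 then (1 : L) else 0)).Local v))), ((((E₂ (t : ((cmDatum L 2 (Matrix.of fun i j : Fin 2 => if i.val + j.val + 1 = 2 then (1 : L) else 0)).Local v × (cmDatum L 1 (Matrix.of fun i j : Fin 1 => if i.val + j.val + 1 = 1 then (1 : L) else 0)).Local v)).1 : ↥(unitaryGroupOfForm (galAdicCompletionMap (L := L) (IsCMField.complexConj L) hw) (placeForm (Matrix.of fun i j : Fin 2 => if i.val + j.val + 1 = 2 then (1 : L) else 0) w.1))) : GL (Fin 2) (w.1.adicCompletion L)) : Matrix (Fin 2) (Fin 2) (w.1.adicCompletion L))) 0 0 ≠ 0 →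
      Matrix.diagonal ![1, α] * ((((E₂ (t : ((cmDatum L 2 (Matrix.of fun i j : Fin 2 => if i.val + j.val + 1 = 2 then (1 : L) else 0)).Local v × (cmDatum L 1 (Matrix.of fun i j : Fin 1 => if i.val + j.val + 1 = 1 then (1 : L) else 0)).Local v)).1 : ↥(unitaryGroupOfForm (galAdicCompletionMap (L := L) (IsCMField.complexConj L) hw) (placeForm (Matrix.of fun i j : Fin 2 => if i.val + j.val + 1 = 2 then (1 : L) else 0) w.1))) : GL (Fin 2) (w.1.adicCompletion L)) : Matrix (Fin 2) (Fin 2) (w.1.adicCompletion L))) * Matrix.diagonal ![1, α⁻¹] = (((((E₂ (t : ((cmDatum L 2 (Matrix.of fun i j : Fin 2 => if i.val + j.val + 1 = 2 then (1 : L) else 0)).Local v × (cmDatum L 1 (Matrix.of fun i j : Fin 1 => if i.val + j.val + 1 = 1 then (1 : L) else 0)).Local v)).1 : ↥(unitaryGroupOfForm (galAdicCompletionMap (L := L) (IsCMField.complexConj L) hw) (placeForm (Matrix.of fun i j : Fin 2 => if i.val + j.val + 1 = 2 then (1 : L) else 0) w.1))) : GL (Fin 2) (w.1.adicCompletion L))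 : Matrix (Fin 2) (Fin 2) (w.1.adicCompletion L))) 0 0) • (!![(1 : (v.adicCompletion ↥(maximalRealSubfield L))), (bF t / aF t) * v₀; bF t / aF t, 1 + (bF t / aF t) * u₀]).map (toPlace v w) := by
    intro t h
    obtain ⟨-, ha⟩ := hsa t h
    rw [hG t, h00 t]
    exact smul_map_regRep_eq_smul_map_regRepOne (toPlace v w) (sF t) ha
  have hιβ : ∀ t : ↥(Subgroup.centralizer ({t₀} : Set ((cmDatum L 2 (Matrix.of fun i j : Fin 2 => if i.val + j.val + 1 = 2 then (1 : L) else 0)).Local v × (cmDatum L 1 (Matrix.of fun i j : Fin 1 => if i.val + j.val + 1 = 1 then (1 : L) else 0)).Local v))), ((((E₂ (t : ((cmDatum L 2 (Matrix.of fun i j : Fin 2 => if i.val + j.val + 1 = 2 then (1 : L) else 0)).Local v × (cmDatum L 1 (Matrix.of fun i j : Fin 1 => if i.val + j.val + 1 = 1 then (1 : L) else 0)).Local v)).1 : ↥(unitaryGroupOfForm (galAdicCompletionMap (L := L) (IsCMField.complexConj L) hw) (placeForm (Matrix.of fun i j : Fin 2 => if i.val + j.val + 1 = 2 then (1 : L)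 else 0) w.1))) : GL (Fin 2) (w.1.adicCompletion L)) : Matrix (Fin 2) (Fin 2) (w.1.adicCompletion L))) 0 0 ≠ 0 → toPlace v w (bF t / aF t) = α * ((((E₂ (t : ((cmDatum L 2 (Matrix.of fun i j : Fin 2 => if i.val + j.val + 1 = 2 then (1 : L) else 0)).Local v × (cmDatum L 1 (Matrix.of fun i j : Fin 1 => if i.val + j.val + 1 = 1 then (1 : L) else 0)).Local v)).1 : ↥(unitaryGroupOfForm (galAdicCompletionMap (L := L) (IsCMField.complexConj L) hw) (placeForm (Matrix.of fun i j : Fin 2 => if i.val + j.val + 1 = 2 then (1 : L) else 0) w.1))) : GL (Fin 2) (w.1.adicCompletion L)) : Matrix (Fin 2) (Fin 2) (w.1.adicCompletion L))) 1 0 / ((((E₂ (t : ((cmDatum L 2 (Matrix.of fun i j : Fin 2 => if i.val + j.val + 1 = 2 then (1 : L) else 0)).Local v × (cmDatum L 1 (Matrix.of fun i j : Fin 1 => if i.val + j.val + 1 = 1 then (1 : L) else 0)).Local v)).1 : ↥(unitaryGroupOfForm (galAdicCompletionMap (L := L) (IsCMField.complexConj L) hw) (placeForm (Matrix.of fun i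 j : Fin 2 => if i.val + j.val + 1 = 2 then (1 : L) else 0) w.1))) : GL (Fin 2) (w.1.adicCompletion L)) : Matrix (Fin 2) (Fin 2) (w.1.adicCompletion L))) 0 0 := fun t h =>
    (toPlace_div_eq_windowCoord (toPlace v w) (hsa t h).1 (hG t)).symm
  /- §3 the deep regular locus: `a ≠ 0`, `|s ι a| = 1`, `|ι(b∕a)|·|τE − σ τE| = |x₀ − x₁| = exp(−N t)` -/
  obtain ⟨π₁, hπ₁0, hπ₁⟩ : ∃ π₁ : (w.1.adicCompletion L), π₁ ≠ 0 ∧ π₁ * (galAdicCompletionMap (L := L) (IsCMField.complexConj L) hw) τE = τE - (galAdicCompletionMap (L := L) (IsCMField.complexConj L) hw) τE := ⟨(τE - (galAdicCompletionMap (L := L) (IsCMField.complexConj L) hw) τE) / (galAdicCompletionMap (L := L) (IsCMField.complexConj L) hw) τE, div_ne_zero hτd0 hστ0, div_mul_cancel₀ _ hστ0⟩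
  have hper : ∀ t : ↥(Subgroup.centralizer ({t₀} : Set ((cmDatum L 2 (Matrix.of fun i j : Fin 2 => if i.val + j.val + 1 = 2 then (1 : L) else 0)).Local v × (cmDatum L 1 (Matrix.of fun i j : Fin 1 => if i.val + j.val + 1 = 1 then (1 : L) else 0)).Local v))), t ∈ {t : ↥(Subgroup.centralizer ({t₀} : Set ((cmDatum L 2 (Matrix.of fun i j : Fin 2 => if i.val + j.val + 1 = 2 then (1 : L) else 0)).Local v × (cmDatum L 1 (Matrix.of fun i j : Fin 1 => if i.val + j.val + 1 = 1 then (1 : L) else 0)).Local v))) | IsRegularElt ((t : ((cmDatum L 2 (Matrix.of fun i j : Fin 2 => if i.val + j.val + 1 = 2 then (1 : L) else 0)).Local v × (cmDatum L 1 (Matrix.of fun i j : Fin 1 => if i.val + j.val + 1 = 1 then (1 : L) else 0)).Local v)).1.val : GL (Fin 2) (LocalRing L v))} → (-WithZero.log (Valued.v π₁)).toNat + 1 ≤ (-WithZero.log (Valued.v ((((P⁻¹).val * ((t : ((cmDatum L 2 (Matrix.of fun i j : Fin 2 => if i.val + j.val + 1 = 2 then (1 : L) else 0)).Local v × (cmDatum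 L 1 (Matrix.of fun i j : Fin 1 => if i.val + j.val + 1 = 1 then (1 : L) else 0)).Local v)).1.val.val : Matrix (Fin 2) (Fin 2) (LocalRing L v)) * P.val) 0 0 - ((P⁻¹).val * ((t : ((cmDatum L 2 (Matrix.of fun i j : Fin 2 => if i.val + j.val + 1 = 2 then (1 : L) else 0)).Local v × (cmDatum L 1 (Matrix.of fun i j : Fin 1 => if i.val + j.val + 1 = 1 then (1 : L) else 0)).Local v)).1.val.val : Matrix (Fin 2) (Fin 2) (LocalRing L v)) * P.val) 1 1) w))).toNat →
      ((((E₂ (t : ((cmDatum L 2 (Matrix.of fun i j : Fin 2 => if i.val + j.val + 1 = 2 then (1 : L) else 0)).Local v × (cmDatum L 1 (Matrix.of fun i j : Fin 1 => if i.val + j.val + 1 = 1 then (1 : L) else 0)).Local v)).1 : ↥(unitaryGroupOfForm (galAdicCompletionMap (L := L) (IsCMField.complexConj L) hw) (placeForm (Matrix.of fun i j : Fin 2 => if i.val + j.val + 1 = 2 then (1 : L) else 0) w.1))) : GL (Fin 2) (w.1.adicCompletion L)) : Matrix (Fin 2) (Fin 2) (w.1.adicCompletion L))) 0 0 ≠ 0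 ∧ bF t ≠ 0 ∧
      Valued.v (toPlace v w (bF t / aF t)) * Valued.v (τE - (galAdicCompletionMap (L := L) (IsCMField.complexConj L) hw) τE) = Valued.v (((P⁻¹).val * ((t : ((cmDatum L 2 (Matrix.of fun i j : Fin 2 => if i.val + j.val + 1 = 2 then (1 : L) else 0)).Local v × (cmDatum L 1 (Matrix.of fun i j : Fin 1 => if i.val + j.val + 1 = 1 then (1 : L) else 0)).Local v)).1.val.val : Matrix (Fin 2) (Fin 2) (LocalRing L v)) * P.val) 0 0 w - ((P⁻¹).val * ((t : ((cmDatum L 2 (Matrix.of fun i j : Fin 2 => if i.val + j.val + 1 = 2 then (1 : L) else 0)).Local v × (cmDatum L 1 (Matrix.of fun i j : Fin 1 => if i.val + j.val + 1 = 1 then (1 : L) else 0)).Local v)).1.val.val : Matrix (Fin 2) (Fin 2) (LocalRing L v)) * P.val) 1 1 w) ∧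
      Valued.v (((P⁻¹).val * ((t : ((cmDatum L 2 (Matrix.of fun i j : Fin 2 => if i.val + j.val + 1 = 2 then (1 : L) else 0)).Local v × (cmDatum L 1 (Matrix.of fun i j : Fin 1 => if i.val + j.val + 1 = 1 then (1 : L) else 0)).Local v)).1.val.val : Matrix (Fin 2) (Fin 2) (LocalRing L v)) * P.val) 0 0 w - ((P⁻¹).val * ((t : ((cmDatum L 2 (Matrix.of fun i j : Fin 2 => if i.val + j.val + 1 = 2 then (1 : L) else 0)).Local v × (cmDatum L 1 (Matrix.of fun i j : Fin 1 => if i.val + j.val + 1 = 1 then (1 : L) else 0)).Local v)).1.val.val : Matrix (Fin 2) (Fin 2) (LocalRing L v)) * P.val) 1 1 w) = WithZero.exp (-((-WithZero.log (Valued.v ((((P⁻¹).val * ((t : ((cmDatum L 2 (Matrix.of fun i j : Fin 2 => if i.val + j.val + 1 = 2 then (1 : L) else 0)).Local v × (cmDatum L 1 (Matrix.of fun i j : Fin 1 => if i.val + j.val + 1 = 1 then (1 : L) else 0)).Local v)).1.val.val : Matrix (Fin 2) (Fin 2) (LocalRing L v)) * P.val) 0 0 - ((P⁻¹).val * ((t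 : ((cmDatum L 2 (Matrix.of fun i j : Fin 2 => if i.val + j.val + 1 = 2 then (1 : L) else 0)).Local v × (cmDatum L 1 (Matrix.of fun i j : Fin 1 => if i.val + j.val + 1 = 1 then (1 : L) else 0)).Local v)).1.val.val : Matrix (Fin 2) (Fin 2) (LocalRing L v)) * P.val) 1 1) w))).toNat : ℤ)) := by
    intro t ht hM
    have hreg : IsRegularElt ((t : ((cmDatum L 2 (Matrix.of fun i j : Fin 2 => if i.val + j.val + 1 = 2 then (1 : L) else 0)).Local v × (cmDatum L 1 (Matrix.of fun i j : Fin 1 => if i.val + j.val + 1 = 1 then (1 : L) else 0)).Local v)).1.val : GL (Fin 2) (LocalRing L v)) := ht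
    have hx1ne : ((P⁻¹).val * ((t : ((cmDatum L 2 (Matrix.of fun i j : Fin 2 => if i.val + j.val + 1 = 2 then (1 : L) else 0)).Local v × (cmDatum L 1 (Matrix.of fun i j : Fin 1 => if i.val + j.val + 1 = 1 then (1 : L) else 0)).Local v)).1.val.val : Matrix (Fin 2) (Fin 2) (LocalRing L v)) * P.val) 1 1 w ≠ 0 := fun h0 => by have h1 := hv1' t; rw [h0, map_zero] at h1; exact zero_ne_one h1
    have hne : ((P⁻¹).val * ((t : ((cmDatum L 2 (Matrix.of fun i j : Fin 2 => if i.val + j.val + 1 = 2 then (1 : L) else 0)).Local v × (cmDatum L 1 (Matrix.of fun i j : Fin 1 => if i.val + j.val + 1 = 1 then (1 : L) else 0)).Local v)).1.val.val : Matrix (Fin 2) (Fin 2) (LocalRing L v)) * P.val) 0 0 w ≠ ((P⁻¹).val * ((t : ((cmDatum L 2 (Matrix.of fun i j : Fin 2 => if i.val + j.val + 1 = 2 then (1 : L) else 0)).Local v × (cmDatum L 1 (Matrix.of fun i j : Fin 1 => if i.val + j.val + 1 = 1 then (1 : L) else 0)).Local v)).1.val.val : Matrix (Fin 2) (Fin 2)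 (LocalRing L v)) * P.val) 1 1 w :=
      (localRing_ne_iff_apply_ne L v w hw _ _).1 ((isRegularElt_iff_frameEntry_ne L v w hw t₀ P d ht₀ hP hd1 t).1 hreg)
    have hdiff : (((P⁻¹).val * ((t : ((cmDatum L 2 (Matrix.of fun i j : Fin 2 => if i.val + j.val + 1 = 2 then (1 : L) else 0)).Local v × (cmDatum L 1 (Matrix.of fun i j : Fin 1 => if i.val + j.val + 1 = 1 then (1 : L) else 0)).Local v)).1.val.val : Matrix (Fin 2) (Fin 2) (LocalRing L v)) * P.val) 0 0 - ((P⁻¹).val * ((t : ((cmDatum L 2 (Matrix.of fun i j : Fin 2 => if i.val + j.val + 1 = 2 then (1 : L) else 0)).Local v × (cmDatum L 1 (Matrix.of fun i j : Fin 1 => if i.val + j.val + 1 = 1 then (1 : L) else 0)).Local v)).1.val.val : Matrix (Fin 2) (Fin 2) (LocalRing L v)) * P.val) 1 1) w = ((P⁻¹).val * ((t : ((cmDatum L 2 (Matrix.of fun i j : Fin 2 => if i.val + j.val + 1 = 2 then (1 : L) else 0)).Local v × (cmDatum L 1 (Matrix.of fun i j : Fin 1 => if i.val + j.val + 1 = 1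 then (1 : L) else 0)).Local v)).1.val.val : Matrix (Fin 2) (Fin 2) (LocalRing L v)) * P.val) 0 0 w - ((P⁻¹).val * ((t : ((cmDatum L 2 (Matrix.of fun i j : Fin 2 => if i.val + j.val + 1 = 2 then (1 : L) else 0)).Local v × (cmDatum L 1 (Matrix.of fun i j : Fin 1 => if i.val + j.val + 1 = 1 then (1 : L) else 0)).Local v)).1.val.val : Matrix (Fin 2) (Fin 2) (LocalRing L v)) * P.val) 1 1 w := Pi.sub_apply _ _ _
    have hd0 : ((P⁻¹).val * ((t : ((cmDatum L 2 (Matrix.of fun i j : Fin 2 => if i.val + j.val + 1 = 2 then (1 : L) else 0)).Local v × (cmDatum L 1 (Matrix.of fun i j : Fin 1 => if i.val + j.val + 1 = 1 then (1 : L) else 0)).Local v)).1.val.val : Matrix (Fin 2) (Fin 2) (LocalRing L v)) * P.val) 0 0 w - ((P⁻¹).val * ((t : ((cmDatum L 2 (Matrix.of fun i j : Fin 2 => if i.val + j.val + 1 = 2 then (1 : L) else 0)).Local v × (cmDatum L 1 (Matrix.of fun i j : Fin 1 => if i.val + j.val + 1 = 1 then (1 : L) else 0)).Local v)).1.val.val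 : Matrix (Fin 2) (Fin 2) (LocalRing L v)) * P.val) 1 1 w ≠ 0 := sub_ne_zero.2 hne
    have hdle : Valued.v (((P⁻¹).val * ((t : ((cmDatum L 2 (Matrix.of fun i j : Fin 2 => if i.val + j.val + 1 = 2 then (1 : L) else 0)).Local v × (cmDatum L 1 (Matrix.of fun i j : Fin 1 => if i.val + j.val + 1 = 1 then (1 : L) else 0)).Local v)).1.val.val : Matrix (Fin 2) (Fin 2) (LocalRing L v)) * P.val) 0 0 w - ((P⁻¹).val * ((t : ((cmDatum L 2 (Matrix.of fun i j : Fin 2 => if i.val + j.val + 1 = 2 then (1 : L) else 0)).Local v × (cmDatum L 1 (Matrix.of fun i j : Fin 1 => if i.val + j.val + 1 = 1 then (1 : L) else 0)).Local v)).1.val.val : Matrix (Fin 2) (Fin 2) (LocalRing L v)) * P.val) 1 1 w) ≤ 1 := by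
      refine (Valuation.map_sub _ _ _).trans ?_; rw [hv0' t, hv1' t, max_self]
    have hM' : (-WithZero.log (Valued.v π₁)).toNat + 1 ≤ (-WithZero.log (Valued.v (((P⁻¹).val * ((t : ((cmDatum L 2 (Matrix.of fun i j : Fin 2 => if i.val + j.val + 1 = 2 then (1 : L) else 0)).Local v × (cmDatum L 1 (Matrix.of fun i j : Fin 1 => if i.val + j.val + 1 = 1 then (1 : L) else 0)).Local v)).1.val.val : Matrix (Fin 2) (Fin 2) (LocalRing L v)) * P.val) 0 0 w - ((P⁻¹).val * ((t : ((cmDatum L 2 (Matrix.of fun i j : Fin 2 => if i.val + j.val + 1 = 2 then (1 : L) else 0)).Local v × (cmDatum L 1 (Matrix.of fun i j : Fin 1 => if i.val + j.val + 1 = 1 then (1 : L) else 0)).Local v)).1.val.val : Matrix (Fin 2) (Fin 2) (LocalRing L v)) * P.val) 1 1 w))).toNat := by rw [← hdiff]; exact hM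
    have hlt₁ : Valued.v (((P⁻¹).val * ((t : ((cmDatum L 2 (Matrix.of fun i j : Fin 2 => if i.val + j.val + 1 = 2 then (1 : L) else 0)).Local v × (cmDatum L 1 (Matrix.of fun i j : Fin 1 => if i.val + j.val + 1 = 1 then (1 : L) else 0)).Local v)).1.val.val : Matrix (Fin 2) (Fin 2) (LocalRing L v)) * P.val) 0 0 w - ((P⁻¹).val * ((t : ((cmDatum L 2 (Matrix.of fun i j : Fin 2 => if i.val + j.val + 1 = 2 then (1 : L) else 0)).Local v × (cmDatum L 1 (Matrix.of fun i j : Fin 1 => if i.val + j.val + 1 = 1 then (1 : L) else 0)).Local v)).1.val.val : Matrix (Fin 2) (Fin 2) (LocalRing L v)) * P.val) 1 1 w) < Valued.v π₁ := valued_lt_of_toNat_succ_le hd0 hdle hπ₁0 hM'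
    have hsmall₁ : Valued.v (((P⁻¹).val * ((t : ((cmDatum L 2 (Matrix.of fun i j : Fin 2 => if i.val + j.val + 1 = 2 then (1 : L) else 0)).Local v × (cmDatum L 1 (Matrix.of fun i j : Fin 1 => if i.val + j.val + 1 = 1 then (1 : L) else 0)).Local v)).1.val.val : Matrix (Fin 2) (Fin 2) (LocalRing L v)) * P.val) 0 0 w - ((P⁻¹).val * ((t : ((cmDatum L 2 (Matrix.of fun i j : Fin 2 => if i.val + j.val + 1 = 2 then (1 : L) else 0)).Local v × (cmDatum L 1 (Matrix.of fun i j : Fin 1 => if i.val + j.val + 1 = 1 then (1 : L) else 0)).Local v)).1.val.val : Matrix (Fin 2) (Fin 2) (LocalRing L v)) * P.val) 1 1 w) * Valued.v ((galAdicCompletionMap (L := L) (IsCMField.complexConj L) hw) τE) < Valued.v (τE - (galAdicCompletionMap (L := L) (IsCMField.complexConj L) hw) τE) := by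
      have h := mul_lt_mul_of_pos_right hlt₁ (show (0 : WithZero (Multiplicative ℤ)) < Valued.v ((galAdicCompletionMap (L := L) (IsCMField.complexConj L) hw) τE) from (Valuation.pos_iff _).2 hστ0)
      rwa [← Valuation.map_mul (Valued.v) π₁, hπ₁] at h
    obtain ⟨hs, hb⟩ := descent_scalars_ne_zero (toPlace v w) (hframe t) hDD (hG t) hQu hne hx1ne
    obtain ⟨h10, hcases⟩ := frame_column_cases (toPlace v w) hsum hprod (hframe t) hDD (hG t) hQu hDu hs hb
    have hNexp : Valued.v (((P⁻¹).val * ((t : ((cmDatum L 2 (Matrix.of fun i j : Fin 2 => if i.val + j.val + 1 = 2 then (1 : L) else 0)).Local v × (cmDatum L 1 (Matrix.of fun i j : Fin 1 => if i.val + j.val + 1 = 1 then (1 : L) else 0)).Local v)).1.val.val : Matrix (Fin 2) (Fin 2) (LocalRing L v)) * P.val) 0 0 w - ((P⁻¹).val * ((t : ((cmDatum L 2 (Matrix.of fun i j : Fin 2 => if i.val + j.val + 1 = 2 then (1 : L) else 0)).Local v × (cmDatum L 1 (Matrix.of fun i j : Fin 1 => if i.val + j.val + 1 = 1 then (1 :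 L) else 0)).Local v)).1.val.val : Matrix (Fin 2) (Fin 2) (LocalRing L v)) * P.val) 1 1 w) = WithZero.exp (-((-WithZero.log (Valued.v ((((P⁻¹).val * ((t : ((cmDatum L 2 (Matrix.of fun i j : Fin 2 => if i.val + j.val + 1 = 2 then (1 : L) else 0)).Local v × (cmDatum L 1 (Matrix.of fun i j : Fin 1 => if i.val + j.val + 1 = 1 then (1 : L) else 0)).Local v)).1.val.val : Matrix (Fin 2) (Fin 2) (LocalRing L v)) * P.val) 0 0 - ((P⁻¹).val * ((t : ((cmDatum L 2 (Matrix.of fun i j : Fin 2 => if i.val + j.val + 1 = 2 then (1 : L) else 0)).Local v × (cmDatum L 1 (Matrix.of fun i j : Fin 1 => if i.val + j.val + 1 = 1 then (1 : L) else 0)).Local v)).1.val.val : Matrix (Fin 2) (Fin 2) (LocalRing L v)) * P.val) 1 1) w))).toNat : ℤ)) := by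
      have hx0 : (((P⁻¹).val * ((t : ((cmDatum L 2 (Matrix.of fun i j : Fin 2 => if i.val + j.val + 1 = 2 then (1 : L) else 0)).Local v × (cmDatum L 1 (Matrix.of fun i j : Fin 1 => if i.val + j.val + 1 = 1 then (1 : L) else 0)).Local v)).1.val.val : Matrix (Fin 2) (Fin 2) (LocalRing L v)) * P.val) 0 0 - ((P⁻¹).val * ((t : ((cmDatum L 2 (Matrix.of fun i j : Fin 2 => if i.val + j.val + 1 = 2 then (1 : L) else 0)).Local v × (cmDatum L 1 (Matrix.of fun i j : Fin 1 => if i.val + j.val + 1 = 1 then (1 : L) else 0)).Local v)).1.val.val : Matrix (Fin 2) (Fin 2) (LocalRing L v)) * P.val) 1 1) w ≠ 0 := by rw [hdiff]; exact hd0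
      have hx1 : Valued.v ((((P⁻¹).val * ((t : ((cmDatum L 2 (Matrix.of fun i j : Fin 2 => if i.val + j.val + 1 = 2 then (1 : L) else 0)).Local v × (cmDatum L 1 (Matrix.of fun i j : Fin 1 => if i.val + j.val + 1 = 1 then (1 : L) else 0)).Local v)).1.val.val : Matrix (Fin 2) (Fin 2) (LocalRing L v)) * P.val) 0 0 - ((P⁻¹).val * ((t : ((cmDatum L 2 (Matrix.of fun i j : Fin 2 => if i.val + j.val + 1 = 2 then (1 : L) else 0)).Local v × (cmDatum L 1 (Matrix.of fun i j : Fin 1 => if i.val + j.val + 1 = 1 then (1 : L) else 0)).Local v)).1.val.val : Matrix (Fin 2) (Fin 2) (LocalRing L v)) * P.val) 1 1) w) ≤ 1 := by rw [hdiff]; exact hdle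
      rw [natCast_toNat_neg_log_eq hx0 hx1, neg_neg, WithZero.exp_log ((Valuation.ne_zero_iff _).2 hx0), hdiff]
    have hkey : aF t ≠ 0 ∧ Valued.v (sF t * toPlace v w (aF t)) = 1 ∧
        Valued.v (toPlace v w (bF t / aF t)) * Valued.v (τE - (galAdicCompletionMap (L := L) (IsCMField.complexConj L) hw) τE) = Valued.v (((P⁻¹).val * ((t : ((cmDatum L 2 (Matrix.of fun i j : Fin 2 => if i.val + j.val + 1 = 2 then (1 : L) else 0)).Local v × (cmDatum L 1 (Matrix.of fun i j : Fin 1 => if i.val + j.val + 1 = 1 then (1 : L) else 0)).Local v)).1.val.val : Matrix (Fin 2) (Fin 2) (LocalRing L v)) * P.val) 0 0 w - ((P⁻¹).val * ((t : ((cmDatum L 2 (Matrix.of fun i j : Fin 2 => if i.val + j.val + 1 = 2 then (1 : L) else 0)).Local v × (cmDatum L 1 (Matrix.of fun i j : Fin 1 => if i.val + j.val + 1 = 1 then (1 : L) else 0)).Local v)).1.val.val : Matrix (Fin 2) (Fin 2) (LocalRing L v)) * P.val) 1 1 w) := by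
      rcases hcases with hcol | hcol
      · obtain ⟨hx₀, hx₁⟩ := eigen_labels_of_descent_frame (toPlace v w) hsum hprod (hframe t) hDD (hG t) hcol h10 hQu
        obtain ⟨ha, -, hsa1, hβ⟩ := deep_bounds_of_valued_sub_lt L v w hx₀ hx₁ (hv1' t) hsmall₁
        exact ⟨ha, hsa1, hβ⟩
      · have hcol' : (Matrix.diagonal ![1, α] * (Pw : Matrix (Fin 2) (Fin 2) (w.1.adicCompletion L))) 0 0 = -((galAdicCompletionMap (L := L) (IsCMField.complexConj L) hw) ((galAdicCompletionMap (L := L) (IsCMField.complexConj L) hw) τE)) * (Matrix.diagonal ![1, α] * (Pw : Matrix (Fin 2) (Fin 2) (w.1.adicCompletion L))) 1 0 := by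
          rw [hσσ]; exact hcol
        obtain ⟨hx₀, hx₁⟩ := eigen_labels_of_descent_frame (toPlace v w) hsum' hprod' (hframe t) hDD (hG t) hcol' h10 hQu
        have hsmall₁' : Valued.v (((P⁻¹).val * ((t : ((cmDatum L 2 (Matrix.of fun i j : Fin 2 => if i.val + j.val + 1 = 2 then (1 : L) else 0)).Local v × (cmDatum L 1 (Matrix.of fun i j : Fin 1 => if i.val + j.val + 1 = 1 then (1 : L) else 0)).Local v)).1.val.val : Matrix (Fin 2) (Fin 2) (LocalRing L v)) * P.val) 0 0 w - ((P⁻¹).val * ((t : ((cmDatum L 2 (Matrix.of fun i j : Fin 2 => if i.val + j.val + 1 = 2 then (1 : L) else 0)).Local v × (cmDatum L 1 (Matrix.of fun i j : Fin 1 => if i.val + j.val + 1 = 1 then (1 : L) else 0)).Local v)).1.val.val : Matrix (Fin 2) (Fin 2) (LocalRing L v)) * P.val) 1 1 w) * Valued.v ((galAdicCompletionMap (L := L) (IsCMField.complexConj L) hw) ((galAdicCompletionMap (L := L) (IsCMField.complexConj L) hw) τE)) < Valued.v ((galAdicCompletionMap (L := L) (IsCMField.complexConj L) hw) τE - (galAdicCompletionMap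 (L := L) (IsCMField.complexConj L) hw) ((galAdicCompletionMap (L := L) (IsCMField.complexConj L) hw) τE)) := by
          rw [hσσ, show (galAdicCompletionMap (L := L) (IsCMField.complexConj L) hw) τE - τE = -(τE - (galAdicCompletionMap (L := L) (IsCMField.complexConj L) hw) τE) by ring, Valuation.map_neg, hvστ]; exact hsmall₁
        obtain ⟨ha, -, hsa1, hβ⟩ := deep_bounds_of_valued_sub_lt L v w hx₀ hx₁ (hv1' t) hsmall₁'
        refine ⟨ha, hsa1, ?_⟩
        rw [hσσ, show (galAdicCompletionMap (L := L) (IsCMField.complexConj L) hw) τE - τE = -(τE - (galAdicCompletionMap (L := L) (IsCMField.complexConj L) hw) τE) by ring, Valuation.map_neg] at hβ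
        exact hβ
    obtain ⟨ha, hsa1, hβ⟩ := hkey
    have hX00 : ((((E₂ (t : ((cmDatum L 2 (Matrix.of fun i j : Fin 2 => if i.val + j.val + 1 = 2 then (1 : L) else 0)).Local v × (cmDatum L 1 (Matrix.of fun i j : Fin 1 => if i.val + j.val + 1 = 1 then (1 : L) else 0)).Local v)).1 : ↥(unitaryGroupOfForm (galAdicCompletionMap (L := L) (IsCMField.complexConj L) hw) (placeForm (Matrix.of fun i j : Fin 2 => if i.val + j.val + 1 = 2 then (1 : L) else 0) w.1))) : GL (Fin 2) (w.1.adicCompletion L)) : Matrix (Fin 2) (Fin 2) (w.1.adicCompletion L))) 0 0 ≠ 0 := by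
      rw [h00 t]; intro h0; rw [h0, map_zero] at hsa1; exact zero_ne_one hsa1
    exact ⟨hX00, hb, hβ, hNexp⟩
  /- §4 the external suppliers: (V-deep) level `jD` (★ B-p10, any anti-fixed `α`), (V-top) radius `R` (★ A-p17) -/
  obtain ⟨jD, -, hjD⟩ := exists_depth_shellAverage_eq_of_descent_congr' L v w hw hα0 ν f hf K hKo hKc E₂
  obtain ⟨R, hR⟩ := exists_setIntegral_shellConj_eq_zero_of_lt L v w hw hα hα0 hϖF ν E₂ K x₀ hx₀ hK hKo f hf hu hu1 hv1 hcπ uη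
  /- §5 the constants of the depth dictionary, the threshold, the coordinates -/
  obtain ⟨δ, hδdef⟩ : ∃ δ : ℤ, δ = -WithZero.log (Valued.v (τE - (galAdicCompletionMap (L := L) (IsCMField.complexConj L) hw) τE)) := ⟨_, rfl⟩
  have hvτd : Valued.v (τE - (galAdicCompletionMap (L := L) (IsCMField.complexConj L) hw) τE) = WithZero.exp (-δ) := by
    rw [hδdef, neg_neg, WithZero.exp_log ((Valuation.ne_zero_iff _).2 hτd0)]
  obtain ⟨mfl, hmfldef⟩ : ∃ mfl : ℕ, mfl = (-WithZero.log (Valued.v π₁)).toNat + 1 + 2 * jD + δ.toNat := ⟨_, rfl⟩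
  obtain ⟨β, hβdef⟩ : ∃ β : ↥(Subgroup.centralizer ({t₀} : Set ((cmDatum L 2 (Matrix.of fun i j : Fin 2 => if i.val + j.val + 1 = 2 then (1 : L) else 0)).Local v × (cmDatum L 1 (Matrix.of fun i j : Fin 1 => if i.val + j.val + 1 = 1 then (1 : L) else 0)).Local v))) → (v.adicCompletion ↥(maximalRealSubfield L)), ∀ t, β t = bF t / aF t := ⟨_, fun _ => rfl⟩
  obtain ⟨oT, hoTdef⟩ : ∃ oT : ↥(Subgroup.centralizer ({t₀} : Set ((cmDatum L 2 (Matrix.of fun i j : Fin 2 => if i.val + j.val + 1 = 2 then (1 : L) else 0)).Local v × (cmDatum L 1 (Matrix.of fun i j : Fin 1 => if i.val + j.val + 1 = 1 then (1 : L) else 0)).Local v))) → ℕ, ∀ t, oT t = (-WithZero.log (Valued.v (β t))).toNat := ⟨_, fun _ => rfl⟩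
  /- §6 the depth law on the deep regular locus: `X₀₀ ≠ 0`, `β t ≠ 0`, `|β t| = exp(−oT t)`, `2·oT t = N t − δ`, `jD ≤ oT t` -/
  have hdeepT : ∀ t : ↥(Subgroup.centralizer ({t₀} : Set ((cmDatum L 2 (Matrix.of fun i j : Fin 2 => if i.val + j.val + 1 = 2 then (1 : L) else 0)).Local v × (cmDatum L 1 (Matrix.of fun i j : Fin 1 => if i.val + j.val + 1 = 1 then (1 : L) else 0)).Local v))), t ∈ {t : ↥(Subgroup.centralizer ({t₀} : Set ((cmDatum L 2 (Matrix.of fun i j : Fin 2 => if i.val + j.val + 1 = 2 then (1 : L) else 0)).Local v × (cmDatum L 1 (Matrix.of fun i j : Fin 1 => if i.val + j.val + 1 = 1 then (1 : L) else 0)).Local v))) | IsRegularElt ((t : ((cmDatum L 2 (Matrix.of fun i j : Fin 2 => if i.val + j.val + 1 = 2 then (1 : L) else 0)).Local v × (cmDatum L 1 (Matrix.of fun i j : Fin 1 => if i.val + j.val + 1 = 1 then (1 : L) else 0)).Local v)).1.val : GL (Fin 2) (LocalRing L v))} → mfl ≤ (-WithZero.log (Valued.v ((((P⁻¹).val * ((t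 : ((cmDatum L 2 (Matrix.of fun i j : Fin 2 => if i.val + j.val + 1 = 2 then (1 : L) else 0)).Local v × (cmDatum L 1 (Matrix.of fun i j : Fin 1 => if i.val + j.val + 1 = 1 then (1 : L) else 0)).Local v)).1.val.val : Matrix (Fin 2) (Fin 2) (LocalRing L v)) * P.val) 0 0 - ((P⁻¹).val * ((t : ((cmDatum L 2 (Matrix.of fun i j : Fin 2 => if i.val + j.val + 1 = 2 then (1 : L) else 0)).Local v × (cmDatum L 1 (Matrix.of fun i j : Fin 1 => if i.val + j.val + 1 = 1 then (1 : L) else 0)).Local v)).1.val.val : Matrix (Fin 2) (Fin 2) (LocalRing L v)) * P.val) 1 1) w))).toNat →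
      ((((E₂ (t : ((cmDatum L 2 (Matrix.of fun i j : Fin 2 => if i.val + j.val + 1 = 2 then (1 : L) else 0)).Local v × (cmDatum L 1 (Matrix.of fun i j : Fin 1 => if i.val + j.val + 1 = 1 then (1 : L) else 0)).Local v)).1 : ↥(unitaryGroupOfForm (galAdicCompletionMap (L := L) (IsCMField.complexConj L) hw) (placeForm (Matrix.of fun i j : Fin 2 => if i.val + j.val + 1 = 2 then (1 : L) else 0) w.1))) : GL (Fin 2) (w.1.adicCompletion L)) : Matrix (Fin 2) (Fin 2) (w.1.adicCompletion L))) 0 0 ≠ 0 ∧ β t ≠ 0 ∧ Valued.v (β t) = WithZero.exp (-(oT t : ℤ)) ∧ (2 * (oT t : ℤ) = ((-WithZero.log (Valued.v ((((P⁻¹).val * ((t : ((cmDatum L 2 (Matrix.of fun i j : Fin 2 => if i.val + j.val + 1 = 2 then (1 : L) else 0)).Local v × (cmDatum L 1 (Matrix.of fun i j : Fin 1 => if i.val + j.val + 1 = 1 then (1 : L) else 0)).Local v)).1.val.val : Matrix (Fin 2) (Fin 2) (LocalRing L v)) * P.val) 0 0 - ((P⁻¹).val * ((t : ((cmDatum L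 2 (Matrix.of fun i j : Fin 2 => if i.val + j.val + 1 = 2 then (1 : L) else 0)).Local v × (cmDatum L 1 (Matrix.of fun i j : Fin 1 => if i.val + j.val + 1 = 1 then (1 : L) else 0)).Local v)).1.val.val : Matrix (Fin 2) (Fin 2) (LocalRing L v)) * P.val) 1 1) w))).toNat : ℤ) - δ) ∧ jD ≤ oT t := by
    intro t ht hm
    rw [hmfldef] at hm
    obtain ⟨hM, hNδ, h2j⟩ := thresholds_of_le hm
    obtain ⟨hX00, hb, hβv, hNexp⟩ := hper t ht hM
    obtain ⟨-, ha⟩ := hsa t hX00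
    have hβ0 : β t ≠ 0 := by rw [hβdef t]; exact div_ne_zero hb ha
    have hvβ0 : Valued.v (β t) ≠ 0 := (Valuation.ne_zero_iff _).2 hβ0
    -- `|β|² · exp(−δ) = exp(−N)`
    rw [← hβdef t, valued_toPlace_eq_sq_of_ramified L v w hw he, hvτd, hNexp] at hβv
    obtain ⟨kβ, hkβ⟩ : ∃ kβ : ℤ, Valued.v (β t) = WithZero.exp kβ := ⟨WithZero.log (Valued.v (β t)), (WithZero.exp_log hvβ0).symm⟩
    rw [hkβ, ← WithZero.exp_nsmul, ← WithZero.exp_add] at hβv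
    have hlin := WithZero.exp_injective hβv
    simp only [nsmul_eq_mul, Nat.cast_ofNat] at hlin
    obtain ⟨hk0, hjk, h2k⟩ := depth_arith hlin (Int.self_le_toNat δ) hNδ h2j
    have hoTk : (oT t : ℤ) = -kβ := by
      rw [hoTdef t, hkβ, WithZero.log_exp, Int.toNat_of_nonneg hk0]
    refine ⟨hX00, hβ0, ?_, by rw [hoTk]; exact h2k, by rw [← Int.ofNat_le, hoTk]; exact hjk⟩
    rw [hkβ, hoTk, neg_neg]
  /- §7 (hdeep): ★ B-p10 (V-deep) at the shell conjugates `S := (D_c^m)⁻¹ N(β) D_c^m`, `S′ := D_uF S D_uF⁻¹` -/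
  have hdeep : ∀ t : ↥(Subgroup.centralizer ({t₀} : Set ((cmDatum L 2 (Matrix.of fun i j : Fin 2 => if i.val + j.val + 1 = 2 then (1 : L) else 0)).Local v × (cmDatum L 1 (Matrix.of fun i j : Fin 1 => if i.val + j.val + 1 = 1 then (1 : L) else 0)).Local v))), t ∈ {t : ↥(Subgroup.centralizer ({t₀} : Set ((cmDatum L 2 (Matrix.of fun i j : Fin 2 => if i.val + j.val + 1 = 2 then (1 : L) else 0)).Local v × (cmDatum L 1 (Matrix.of fun i j : Fin 1 => if i.val + j.val + 1 = 1 then (1 : L) else 0)).Local v))) | IsRegularElt ((t : ((cmDatum L 2 (Matrix.of fun i j : Fin 2 => if i.val + j.val + 1 = 2 then (1 : L) else 0)).Local v × (cmDatum L 1 (Matrix.of fun i j : Fin 1 => if i.val + j.val + 1 = 1 then (1 : L) else 0)).Local v)).1.val : GL (Fin 2) (LocalRing L v))} → mfl ≤ (-WithZero.log (Valued.v ((((P⁻¹).val * ((t : ((cmDatum L 2 (Matrix.of fun i j : Fin 2 => if i.val + j.val + 1 = 2 then (1 : L) else 0)).Local v × (cmDatum L 1 (Matrix.of fun i j : Fin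 1 => if i.val + j.val + 1 = 1 then (1 : L) else 0)).Local v)).1.val.val : Matrix (Fin 2) (Fin 2) (LocalRing L v)) * P.val) 0 0 - ((P⁻¹).val * ((t : ((cmDatum L 2 (Matrix.of fun i j : Fin 2 => if i.val + j.val + 1 = 2 then (1 : L) else 0)).Local v × (cmDatum L 1 (Matrix.of fun i j : Fin 1 => if i.val + j.val + 1 = 1 then (1 : L) else 0)).Local v)).1.val.val : Matrix (Fin 2) (Fin 2) (LocalRing L v)) * P.val) 1 1) w))).toNat → ∀ m, m + jD ≤ oT t → (∫ k in (((K).prod (⊤ : Subgroup ((cmDatum L 1 (Matrix.of fun i j : Fin 1 => if i.val + j.val + 1 = 1 then (1 : L) else 0)).Local v)) : Subgroup ((cmDatum L 2 (Matrix.of fun i j : Fin 2 => if i.val + j.val + 1 = 2 then (1 : L) else 0)).Local v × (cmDatum L 1 (Matrix.of fun i j : Fin 1 => if i.val + j.val + 1 = 1 then (1 : L) else 0)).Local v)) : Set ((cmDatum L 2 (Matrix.of fun i j : Fin 2 => if i.val + j.val + 1 = 2 then (1 : L) else 0)).Local v × (cmDatum L 1 (Matrix.of fun i j : Fin 1 =>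 if i.val + j.val + 1 = 1 then (1 : L) else 0)).Local v)), f (k⁻¹ * (((E₂.symm (uη⁻¹ ^ (m)), (1 : (cmDatum L 1 (Matrix.of fun i j : Fin 1 => if i.val + j.val + 1 = 1 then (1 : L) else 0)).Local v)) : ((cmDatum L 2 (Matrix.of fun i j : Fin 2 => if i.val + j.val + 1 = 2 then (1 : L) else 0)).Local v × (cmDatum L 1 (Matrix.of fun i j : Fin 1 => if i.val + j.val + 1 = 1 then (1 : L) else 0)).Local v))⁻¹ * ((t : ((cmDatum L 2 (Matrix.of fun i j : Fin 2 => if i.val + j.val + 1 = 2 then (1 : L) else 0)).Local v × (cmDatum L 1 (Matrix.of fun i j : Fin 1 => if i.val + j.val + 1 = 1 then (1 : L) else 0)).Local v))) * (E₂.symm (uη⁻¹ ^ (m)), 1)) * k) ∂ν) = (∫ k in (((K).prod (⊤ : Subgroup ((cmDatum L 1 (Matrix.of fun i j : Fin 1 => if i.val + j.val + 1 = 1 then (1 : L) else 0)).Local v)) : Subgroup ((cmDatum L 2 (Matrix.of fun i j : Fin 2 => if i.val + j.val + 1 = 2 then (1 : L) else 0)).Local v × (cmDatum L 1 (Matrix.of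 fun i j : Fin 1 => if i.val + j.val + 1 = 1 then (1 : L) else 0)).Local v)) : Set ((cmDatum L 2 (Matrix.of fun i j : Fin 2 => if i.val + j.val + 1 = 2 then (1 : L) else 0)).Local v × (cmDatum L 1 (Matrix.of fun i j : Fin 1 => if i.val + j.val + 1 = 1 then (1 : L) else 0)).Local v)), f (k⁻¹ * (((E₂.symm (uη⁻¹ ^ (m)), (1 : (cmDatum L 1 (Matrix.of fun i j : Fin 1 => if i.val + j.val + 1 = 1 then (1 : L) else 0)).Local v)) : ((cmDatum L 2 (Matrix.of fun i j : Fin 2 => if i.val + j.val + 1 = 2 then (1 : L) else 0)).Local v × (cmDatum L 1 (Matrix.of fun i j : Fin 1 => if i.val + j.val + 1 = 1 then (1 : L) else 0)).Local v))⁻¹ * (e (t : ((cmDatum L 2 (Matrix.of fun i j : Fin 2 => if i.val + j.val + 1 = 2 then (1 : L) else 0)).Local v × (cmDatum L 1 (Matrix.of fun i j : Fin 1 => if i.val + j.val + 1 = 1 then (1 : L) else 0)).Local v))) * (E₂.symm (uη⁻¹ ^ (m)), 1)) * k) ∂ν) := by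
    intro t ht hm m hmj
    obtain ⟨hX00, hβ0, hvβ, -, -⟩ := hdeepT t ht hm
    have hvβ' : Valued.v (bF t / aF t) = WithZero.exp (-(oT t : ℤ)) := by rw [← hβdef t]; exact hvβ
    have hT := hN1 t hX00
    -- `N(β)` as an element of `GL₂(L⁺_v)`
    have hdetN : (!![(1 : (v.adicCompletion ↥(maximalRealSubfield L))), (bF t / aF t) * v₀; bF t / aF t, 1 + (bF t / aF t) * u₀]).det ≠ 0 :=
      det_ne_zero_of_descent (toPlace v w) hα0 ((E₂ (t : ((cmDatum L 2 (Matrix.of fun i j : Fin 2 => if i.val + j.val + 1 = 2 then (1 : L) else 0)).Local v × (cmDatum L 1 (Matrix.of fun i j : Fin 1 => if i.val + j.val + 1 = 1 then (1 : L) else 0)).Local v)).1 : ↥(unitaryGroupOfForm (galAdicCompletionMap (L := L) (IsCMField.complexConj L) hw) (placeForm (Matrix.of fun i j : Fin 2 => if i.val + j.val + 1 = 2 then (1 : L) else 0) w.1))) : GL (Fin 2) (w.1.adicCompletion L)) hT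
    obtain ⟨γ₁, hγ₁⟩ : ∃ γ₁ : GL (Fin 2) (v.adicCompletion ↥(maximalRealSubfield L)), ((γ₁ : GL (Fin 2) (v.adicCompletion ↥(maximalRealSubfield L))) : Matrix (Fin 2) (Fin 2) (v.adicCompletion ↥(maximalRealSubfield L))) = !![(1 : (v.adicCompletion ↥(maximalRealSubfield L))), (bF t / aF t) * v₀; bF t / aF t, 1 + (bF t / aF t) * u₀] :=
      ⟨Matrix.GeneralLinearGroup.mk'' _ (isUnit_iff_ne_zero.2 hdetN), rfl⟩
    have hTγ : Matrix.diagonal ![1, α] * ((((E₂ (t : ((cmDatum L 2 (Matrix.of fun i j : Fin 2 => if i.val + j.val + 1 = 2 then (1 : L) else 0)).Local v × (cmDatum L 1 (Matrix.of fun i j : Fin 1 => if i.val + j.val + 1 = 1 then (1 : L) else 0)).Local v)).1 : ↥(unitaryGroupOfForm (galAdicCompletionMap (L := L) (IsCMField.complexConj L) hw) (placeForm (Matrix.of fun i j : Fin 2 => if i.val + j.val + 1 = 2 then (1 : L) else 0) w.1))) : GL (Fin 2) (w.1.adicCompletion L)) : Matrix (Fin 2) (Fin 2) (w.1.adicCompletion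 L))) * Matrix.diagonal ![1, α⁻¹] = (((((E₂ (t : ((cmDatum L 2 (Matrix.of fun i j : Fin 2 => if i.val + j.val + 1 = 2 then (1 : L) else 0)).Local v × (cmDatum L 1 (Matrix.of fun i j : Fin 1 => if i.val + j.val + 1 = 1 then (1 : L) else 0)).Local v)).1 : ↥(unitaryGroupOfForm (galAdicCompletionMap (L := L) (IsCMField.complexConj L) hw) (placeForm (Matrix.of fun i j : Fin 2 => if i.val + j.val + 1 = 2 then (1 : L) else 0) w.1))) : GL (Fin 2) (w.1.adicCompletion L)) : Matrix (Fin 2) (Fin 2) (w.1.adicCompletion L))) 0 0) • (((γ₁ : GL (Fin 2) (v.adicCompletion ↥(maximalRealSubfield L))) : Matrix (Fin 2) (Fin 2) (v.adicCompletion ↥(maximalRealSubfield L)))).map (toPlace v w) := by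
      rw [hγ₁]; exact hT
    -- the shell conjugate of `T`
    have hS := descent_shellConjugate L v w hw hα0 uη (E₂ (t : ((cmDatum L 2 (Matrix.of fun i j : Fin 2 => if i.val + j.val + 1 = 2 then (1 : L) else 0)).Local v × (cmDatum L 1 (Matrix.of fun i j : Fin 1 => if i.val + j.val + 1 = 1 then (1 : L) else 0)).Local v)).1) hηE0 huη hc0 hc m hTγ
    have hSmat : ((((glDiagonal 2 (v.adicCompletion ↥(maximalRealSubfield L)) ![1, Units.mk0 (c) (hc0)]) ^ m)⁻¹ * γ₁ * (glDiagonal 2 (v.adicCompletion ↥(maximalRealSubfield L)) ![1, Units.mk0 (c) (hc0)]) ^ m : GL (Fin 2) (v.adicCompletion ↥(maximalRealSubfield L))) : Matrix (Fin 2) (Fin 2) (v.adicCompletion ↥(maximalRealSubfield L))) =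
        !![(1 : (v.adicCompletion ↥(maximalRealSubfield L))), (bF t / aF t) * v₀ * c ^ m; (bF t / aF t) * (c ^ m)⁻¹, 1 + (bF t / aF t) * u₀] :=
      coe_glDiagonal_pow_conj_regRep L v hc0 m u₀ v₀ 1 (bF t / aF t) hγ₁
    -- the partner `T′ = D_u T D_u⁻¹` and its shell conjugate
    have hd1 : (((glDiagonal 2 (w.1.adicCompletion L) ![1, u]) : GL (Fin 2) (w.1.adicCompletion L)) : Matrix (Fin 2) (Fin 2) (w.1.adicCompletion L)) = Matrix.diagonal ![1, toPlace v w uF] := by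
      rw [coe_glDiagonal]; congr 1; funext k; fin_cases k <;> simp [huu]
    have hd2 : ((((glDiagonal 2 (w.1.adicCompletion L) ![1, u]))⁻¹ : GL (Fin 2) (w.1.adicCompletion L)) : Matrix (Fin 2) (Fin 2) (w.1.adicCompletion L)) = Matrix.diagonal ![1, (toPlace v w uF)⁻¹] := by
      rw [← map_inv, coe_glDiagonal]; congr 1; funext k; fin_cases k <;> simp [huu]
    have hT'mat : ((((E₂ (e (t : ((cmDatum L 2 (Matrix.of fun i j : Fin 2 => if i.val + j.val + 1 = 2 then (1 : L) else 0)).Local v × (cmDatum L 1 (Matrix.of fun i j : Fin 1 => if i.val + j.val + 1 = 1 then (1 : L) else 0)).Local v))).1 : ↥(unitaryGroupOfForm (galAdicCompletionMap (L := L) (IsCMField.complexConj L) hw) (placeForm (Matrix.of fun i j : Fin 2 => if i.val + j.val + 1 = 2 then (1 : L) else 0) w.1))) : GL (Fin 2) (w.1.adicCompletion L)) : Matrix (Fin 2) (Fin 2) (w.1.adicCompletion L))) = Matrix.diagonal ![1, toPlace v w uF] * ((((E₂ (t : ((cmDatum L 2 (Matrix.of fun i j : Fin 2 => if i.val + j.val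 + 1 = 2 then (1 : L) else 0)).Local v × (cmDatum L 1 (Matrix.of fun i j : Fin 1 => if i.val + j.val + 1 = 1 then (1 : L) else 0)).Local v)).1 : ↥(unitaryGroupOfForm (galAdicCompletionMap (L := L) (IsCMField.complexConj L) hw) (placeForm (Matrix.of fun i j : Fin 2 => if i.val + j.val + 1 = 2 then (1 : L) else 0) w.1))) : GL (Fin 2) (w.1.adicCompletion L)) : Matrix (Fin 2) (Fin 2) (w.1.adicCompletion L))) * Matrix.diagonal ![1, (toPlace v w uF)⁻¹] := by
      rw [hconj (t : ((cmDatum L 2 (Matrix.of fun i j : Fin 2 => if i.val + j.val + 1 = 2 then (1 : L) else 0)).Local v × (cmDatum L 1 (Matrix.of fun i j : Fin 1 => if i.val + j.val + 1 = 1 then (1 : L) else 0)).Local v)), Units.val_mul, Units.val_mul, hd1, hd2]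
    have hcD1 : (((glDiagonal 2 (v.adicCompletion ↥(maximalRealSubfield L)) ![1, Units.mk0 (uF) (huF0)]) : GL (Fin 2) (v.adicCompletion ↥(maximalRealSubfield L))) : Matrix (Fin 2) (Fin 2) (v.adicCompletion ↥(maximalRealSubfield L))) = Matrix.diagonal ![1, uF] := by
      rw [coe_glDiagonal]; congr 1; funext k; fin_cases k <;> simp
    have hcD2 : ((((glDiagonal 2 (v.adicCompletion ↥(maximalRealSubfield L)) ![1, Units.mk0 (uF) (huF0)]))⁻¹ : GL (Fin 2) (v.adicCompletion ↥(maximalRealSubfield L))) : Matrix (Fin 2) (Fin 2) (v.adicCompletion ↥(maximalRealSubfield L))) = Matrix.diagonal ![1, uF⁻¹] := by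
      rw [← map_inv, coe_glDiagonal]; congr 1; funext k; fin_cases k <;> simp
    have hT'desc : Matrix.diagonal ![1, α] * ((((E₂ (e (t : ((cmDatum L 2 (Matrix.of fun i j : Fin 2 => if i.val + j.val + 1 = 2 then (1 : L) else 0)).Local v × (cmDatum L 1 (Matrix.of fun i j : Fin 1 => if i.val + j.val + 1 = 1 then (1 : L) else 0)).Local v))).1 : ↥(unitaryGroupOfForm (galAdicCompletionMap (L := L) (IsCMField.complexConj L) hw) (placeForm (Matrix.of fun i j : Fin 2 => if i.val + j.val + 1 = 2 then (1 : L) else 0) w.1))) : GL (Fin 2) (w.1.adicCompletion L)) : Matrix (Fin 2) (Fin 2) (w.1.adicCompletion L))) * Matrix.diagonal ![1, α⁻¹] = (((((E₂ (t : ((cmDatum L 2 (Matrix.of fun i j : Fin 2 => if i.val + j.val + 1 = 2 then (1 : L) else 0)).Local v × (cmDatum L 1 (Matrix.of fun i j : Fin 1 => if i.val + j.val + 1 = 1 then (1 : L) else 0)).Local v)).1 : ↥(unitaryGroupOfForm (galAdicCompletionMap (L := L) (IsCMField.complexConj L) hw) (placeForm (Matrix.of fun i j : Fin 2 => if i.val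 + j.val + 1 = 2 then (1 : L) else 0) w.1))) : GL (Fin 2) (w.1.adicCompletion L)) : Matrix (Fin 2) (Fin 2) (w.1.adicCompletion L))) 0 0) • ((((glDiagonal 2 (v.adicCompletion ↥(maximalRealSubfield L)) ![1, Units.mk0 (uF) (huF0)]) * γ₁ * (glDiagonal 2 (v.adicCompletion ↥(maximalRealSubfield L)) ![1, Units.mk0 (uF) (huF0)])⁻¹ : GL (Fin 2) (v.adicCompletion ↥(maximalRealSubfield L))) : Matrix (Fin 2) (Fin 2) (v.adicCompletion ↥(maximalRealSubfield L)))).map (toPlace v w) := by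
      rw [hT'mat, descent_conj_diagonal_eq (toPlace v w) α uF hTγ, Units.val_mul, Units.val_mul, hcD1, hcD2]
    have hS'₀ := descent_shellConjugate L v w hw hα0 uη (E₂ (e (t : ((cmDatum L 2 (Matrix.of fun i j : Fin 2 => if i.val + j.val + 1 = 2 then (1 : L) else 0)).Local v × (cmDatum L 1 (Matrix.of fun i j : Fin 1 => if i.val + j.val + 1 = 1 then (1 : L) else 0)).Local v))).1) hηE0 huη hc0 hc m hT'desc
    have hcomm : Commute ((glDiagonal 2 (v.adicCompletion ↥(maximalRealSubfield L)) ![1, Units.mk0 (c) (hc0)]) ^ m) (glDiagonal 2 (v.adicCompletion ↥(maximalRealSubfield L)) ![1, Units.mk0 (uF) (huF0)]) :=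
      (commute_glDiagonal 2 (v.adicCompletion ↥(maximalRealSubfield L)) _ _).pow_left m
    rw [conj_conj_eq_of_commute hcomm] at hS'₀
    -- the two congruences modulo `exp(−jD)` from `m + jD ≤ oT t`
    have hpowinv : (WithZero.exp (-1 : ℤ) ^ m)⁻¹ = WithZero.exp (m : ℤ) := by
      rw [← WithZero.exp_nsmul, ← WithZero.exp_neg]; congr 1; simp
    have hbm : Valued.v ((bF t / aF t) * (c ^ m)⁻¹) ≤ Valued.v c ^ jD := by
      rw [hvcj, map_mul, map_inv₀, map_pow, hvc, hpowinv, hvβ', ← WithZero.exp_add]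
      exact WithZero.exp_le_exp.2 (neg_add_le_neg_of_add_le hmj)
    have hcongS : ∀ i k, Valued.v (((((((glDiagonal 2 (v.adicCompletion ↥(maximalRealSubfield L)) ![1, Units.mk0 (c) (hc0)]) ^ m)⁻¹ * γ₁ * (glDiagonal 2 (v.adicCompletion ↥(maximalRealSubfield L)) ![1, Units.mk0 (c) (hc0)]) ^ m : GL (Fin 2) (v.adicCompletion ↥(maximalRealSubfield L))) : Matrix (Fin 2) (Fin 2) (v.adicCompletion ↥(maximalRealSubfield L)))) - 1) i k) ≤ WithZero.exp (-(jD : ℤ)) := by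
      have h := Literature.NumberTheory.LocalFields.QuadraticRegularRep.forall_v_shellConj_sub_smul_one_le u₀ v₀ hu' hv' c hc0 (by rw [hvc, ← WithZero.exp_zero]; exact WithZero.exp_le_exp.2 (by norm_num)) m jD 1 (bF t / aF t) hbm
      rw [one_smul, hvcj] at h
      intro i k
      rw [hSmat]
      exact h i k
    have hcongS' : ∀ i k, Valued.v (((((glDiagonal 2 (v.adicCompletion ↥(maximalRealSubfield L)) ![1, Units.mk0 (uF) (huF0)]) * (((glDiagonal 2 (v.adicCompletion ↥(maximalRealSubfield L)) ![1, Units.mk0 (c) (hc0)]) ^ m)⁻¹ * γ₁ * (glDiagonal 2 (v.adicCompletion ↥(maximalRealSubfield L)) ![1, Units.mk0 (c) (hc0)]) ^ m) * (glDiagonal 2 (v.adicCompletion ↥(maximalRealSubfield L)) ![1, Units.mk0 (uF) (huF0)])⁻¹ : GL (Fin 2) (v.adicCompletion ↥(maximalRealSubfield L))) : Matrix (Fin 2) (Fin 2) (v.adicCompletion ↥(maximalRealSubfield L))) - 1) i k) ≤ WithZero.exp (-(jD : ℤ)) := by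
      have h1 : Valued.v (1 : (v.adicCompletion ↥(maximalRealSubfield L))) = 1 := map_one _
      have h2 : Valued.v uF⁻¹ = 1 := by rw [map_inv₀, huFv, inv_one]
      have h := Literature.NumberTheory.LocalFields.QuadraticRegularRep.forall_v_diagonal_conj_sub_smul_one_le (1 : (v.adicCompletion ↥(maximalRealSubfield L))) uF⁻¹ h1 h2 _ 1 (WithZero.exp (-(jD : ℤ))) (by
        intro i k; rw [one_smul]; exact hcongS i k)
      rw [inv_one, inv_inv, one_smul] at h
      intro i k
      rw [Units.val_mul, Units.val_mul, hcD1, hcD2]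
      exact h i k
    -- ★ (V-deep)
    exact hjD (uη⁻¹ ^ m) (t : ((cmDatum L 2 (Matrix.of fun i j : Fin 2 => if i.val + j.val + 1 = 2 then (1 : L) else 0)).Local v × (cmDatum L 1 (Matrix.of fun i j : Fin 1 => if i.val + j.val + 1 = 1 then (1 : L) else 0)).Local v)) (e (t : ((cmDatum L 2 (Matrix.of fun i j : Fin 2 => if i.val + j.val + 1 = 2 then (1 : L) else 0)).Local v × (cmDatum L 1 (Matrix.of fun i j : Fin 1 => if i.val + j.val + 1 = 1 then (1 : L) else 0)).Local v))) (((((E₂ (t : ((cmDatum L 2 (Matrix.of fun i j : Fin 2 => if i.val + j.val + 1 = 2 then (1 : L) else 0)).Local v × (cmDatum L 1 (Matrix.of fun i j : Fin 1 => if i.val + j.val + 1 = 1 then (1 : L) else 0)).Local v)).1 : ↥(unitaryGroupOfForm (galAdicCompletionMap (L := L) (IsCMField.complexConj L) hw) (placeForm (Matrix.of fun i j : Fin 2 => if i.val + j.val + 1 = 2 then (1 : L) else 0) w.1))) : GL (Fin 2) (w.1.adicCompletion L)) : Matrix (Fin 2) (Fin 2) (w.1.adicCompletion L))) 0 0) _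 _ (he2 (t : ((cmDatum L 2 (Matrix.of fun i j : Fin 2 => if i.val + j.val + 1 = 2 then (1 : L) else 0)).Local v × (cmDatum L 1 (Matrix.of fun i j : Fin 1 => if i.val + j.val + 1 = 1 then (1 : L) else 0)).Local v))) hS hS'₀ hcongS hcongS'
  /- §8 (htop): ★ A-p17 (V-top) at `t` (`D = 1`) and `e t` (`D = D_uF`) -/
  have htop : ∀ t : ↥(Subgroup.centralizer ({t₀} : Set ((cmDatum L 2 (Matrix.of fun i j : Fin 2 => if i.val + j.val + 1 = 2 then (1 : L) else 0)).Local v × (cmDatum L 1 (Matrix.of fun i j : Fin 1 => if i.val + j.val + 1 = 1 then (1 : L) else 0)).Local v))), t ∈ {t : ↥(Subgroup.centralizer ({t₀} : Set ((cmDatum L 2 (Matrix.of fun i j : Fin 2 => if i.val + j.val + 1 = 2 then (1 : L) else 0)).Local v × (cmDatum L 1 (Matrix.of fun i j : Fin 1 => if i.val + j.val + 1 = 1 then (1 : L) else 0)).Local v))) | IsRegularElt ((t : ((cmDatum L 2 (Matrix.of fun i j : Fin 2 => if i.val + j.val + 1 = 2 then (1 : L) else 0)).Local v × (cmDatum L 1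 (Matrix.of fun i j : Fin 1 => if i.val + j.val + 1 = 1 then (1 : L) else 0)).Local v)).1.val : GL (Fin 2) (LocalRing L v))} → mfl ≤ (-WithZero.log (Valued.v ((((P⁻¹).val * ((t : ((cmDatum L 2 (Matrix.of fun i j : Fin 2 => if i.val + j.val + 1 = 2 then (1 : L) else 0)).Local v × (cmDatum L 1 (Matrix.of fun i j : Fin 1 => if i.val + j.val + 1 = 1 then (1 : L) else 0)).Local v)).1.val.val : Matrix (Fin 2) (Fin 2) (LocalRing L v)) * P.val) 0 0 - ((P⁻¹).val * ((t : ((cmDatum L 2 (Matrix.of fun i j : Fin 2 => if i.val + j.val + 1 = 2 then (1 : L) else 0)).Local v × (cmDatum L 1 (Matrix.of fun i j : Fin 1 => if i.val + j.val + 1 = 1 then (1 : L) else 0)).Local v)).1.val.val : Matrix (Fin 2) (Fin 2) (LocalRing L v)) * P.val) 1 1) w))).toNat → ∀ m, oT t + R < m → (∫ k in (((K).prod (⊤ : Subgroup ((cmDatum L 1 (Matrix.of fun i j : Fin 1 => if i.val + j.val + 1 = 1 then (1 : L) else 0)).Local v)) : Subgroup ((cmDatum L 2 (Matrix.of fun i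 j : Fin 2 => if i.val + j.val + 1 = 2 then (1 : L) else 0)).Local v × (cmDatum L 1 (Matrix.of fun i j : Fin 1 => if i.val + j.val + 1 = 1 then (1 : L) else 0)).Local v)) : Set ((cmDatum L 2 (Matrix.of fun i j : Fin 2 => if i.val + j.val + 1 = 2 then (1 : L) else 0)).Local v × (cmDatum L 1 (Matrix.of fun i j : Fin 1 => if i.val + j.val + 1 = 1 then (1 : L) else 0)).Local v)), f (k⁻¹ * (((E₂.symm (uη⁻¹ ^ (m)), (1 : (cmDatum L 1 (Matrix.of fun i j : Fin 1 => if i.val + j.val + 1 = 1 then (1 : L) else 0)).Local v)) : ((cmDatum L 2 (Matrix.of fun i j : Fin 2 => if i.val + j.val + 1 = 2 then (1 : L) else 0)).Local v × (cmDatum L 1 (Matrix.of fun i j : Fin 1 => if i.val + j.val + 1 = 1 then (1 : L) else 0)).Local v))⁻¹ * ((t : ((cmDatum L 2 (Matrix.of fun i j : Fin 2 => if i.val + j.val + 1 = 2 then (1 : L) else 0)).Local v × (cmDatum L 1 (Matrix.of fun i j : Fin 1 => if i.val + j.val + 1 = 1 then (1 : L) else 0)).Local v))) * (E₂.symm (uη⁻¹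 ^ (m)), 1)) * k) ∂ν) = 0 ∧ (∫ k in (((K).prod (⊤ : Subgroup ((cmDatum L 1 (Matrix.of fun i j : Fin 1 => if i.val + j.val + 1 = 1 then (1 : L) else 0)).Local v)) : Subgroup ((cmDatum L 2 (Matrix.of fun i j : Fin 2 => if i.val + j.val + 1 = 2 then (1 : L) else 0)).Local v × (cmDatum L 1 (Matrix.of fun i j : Fin 1 => if i.val + j.val + 1 = 1 then (1 : L) else 0)).Local v)) : Set ((cmDatum L 2 (Matrix.of fun i j : Fin 2 => if i.val + j.val + 1 = 2 then (1 : L) else 0)).Local v × (cmDatum L 1 (Matrix.of fun i j : Fin 1 => if i.val + j.val + 1 = 1 then (1 : L) else 0)).Local v)), f (k⁻¹ * (((E₂.symm (uη⁻¹ ^ (m)), (1 : (cmDatum L 1 (Matrix.of fun i j : Fin 1 => if i.val + j.val + 1 = 1 then (1 : L) else 0)).Local v)) : ((cmDatum L 2 (Matrix.of fun i j : Fin 2 => if i.val + j.val + 1 = 2 then (1 : L) else 0)).Local v × (cmDatum L 1 (Matrix.of fun i j : Fin 1 => if i.val + j.val + 1 = 1 then (1 : L) else 0)).Local v))⁻¹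 * (e (t : ((cmDatum L 2 (Matrix.of fun i j : Fin 2 => if i.val + j.val + 1 = 2 then (1 : L) else 0)).Local v × (cmDatum L 1 (Matrix.of fun i j : Fin 1 => if i.val + j.val + 1 = 1 then (1 : L) else 0)).Local v))) * (E₂.symm (uη⁻¹ ^ (m)), 1)) * k) ∂ν) = 0 := by
    intro t ht hm m hlt
    obtain ⟨hX00, hβ0, hvβ, -, -⟩ := hdeepT t ht hm
    have hT := hN1 t hX00
    have hdetN : (!![(1 : (v.adicCompletion ↥(maximalRealSubfield L))), (bF t / aF t) * v₀; bF t / aF t, 1 + (bF t / aF t) * u₀]).det ≠ 0 :=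
      det_ne_zero_of_descent (toPlace v w) hα0 ((E₂ (t : ((cmDatum L 2 (Matrix.of fun i j : Fin 2 => if i.val + j.val + 1 = 2 then (1 : L) else 0)).Local v × (cmDatum L 1 (Matrix.of fun i j : Fin 1 => if i.val + j.val + 1 = 1 then (1 : L) else 0)).Local v)).1 : ↥(unitaryGroupOfForm (galAdicCompletionMap (L := L) (IsCMField.complexConj L) hw) (placeForm (Matrix.of fun i j : Fin 2 => if i.val + j.val + 1 = 2 then (1 : L) else 0) w.1))) : GL (Fin 2) (w.1.adicCompletion L)) hT
    obtain ⟨γ₁, hγ₁⟩ : ∃ γ₁ : GL (Fin 2) (v.adicCompletion ↥(maximalRealSubfield L)), ((γ₁ : GL (Fin 2) (v.adicCompletion ↥(maximalRealSubfield L))) : Matrix (Fin 2) (Fin 2) (v.adicCompletion ↥(maximalRealSubfield L))) = !![(1 : (v.adicCompletion ↥(maximalRealSubfield L))), (bF t / aF t) * v₀; bF t / aF t, 1 + (bF t / aF t) * u₀] :=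
      ⟨Matrix.GeneralLinearGroup.mk'' _ (isUnit_iff_ne_zero.2 hdetN), rfl⟩
    have hTγ : Matrix.diagonal ![1, α] * ((((E₂ (t : ((cmDatum L 2 (Matrix.of fun i j : Fin 2 => if i.val + j.val + 1 = 2 then (1 : L) else 0)).Local v × (cmDatum L 1 (Matrix.of fun i j : Fin 1 => if i.val + j.val + 1 = 1 then (1 : L) else 0)).Local v)).1 : ↥(unitaryGroupOfForm (galAdicCompletionMap (L := L) (IsCMField.complexConj L) hw) (placeForm (Matrix.of fun i j : Fin 2 => if i.val + j.val + 1 = 2 then (1 : L) else 0) w.1))) : GL (Fin 2) (w.1.adicCompletion L)) : Matrix (Fin 2) (Fin 2) (w.1.adicCompletion L))) * Matrix.diagonal ![1, α⁻¹] = (((((E₂ (t : ((cmDatum L 2 (Matrix.of fun i j : Fin 2 => if i.val + j.val + 1 = 2 then (1 : L) else 0)).Local v × (cmDatum L 1 (Matrix.of fun i j : Fin 1 => if i.val + j.val + 1 = 1 then (1 : L) else 0)).Local v)).1 : ↥(unitaryGroupOfForm (galAdicCompletionMap (L := L) (IsCMField.complexConj L) hw) (placeForm (Matrix.of fun i j :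 Fin 2 => if i.val + j.val + 1 = 2 then (1 : L) else 0) w.1))) : GL (Fin 2) (w.1.adicCompletion L)) : Matrix (Fin 2) (Fin 2) (w.1.adicCompletion L))) 0 0) • (((γ₁ : GL (Fin 2) (v.adicCompletion ↥(maximalRealSubfield L))) : Matrix (Fin 2) (Fin 2) (v.adicCompletion ↥(maximalRealSubfield L)))).map (toPlace v w) := by
      rw [hγ₁]; exact hT
    have hoTval : valuation (v.adicCompletion ↥(maximalRealSubfield L)) ((bF t / aF t) / 1) = valuation (v.adicCompletion ↥(maximalRealSubfield L)) ϖF ^ oT t := by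
      rw [div_one, ← map_pow]
      refine (v_eq_iff_valuation_eq _ _).1 ?_
      rw [map_pow, hϖF, ← WithZero.exp_nsmul, ← hβdef t, hvβ]
      congr 1; simp
    -- `t`: the `D = 1` form
    have hXm := descent_shellConjugate_regRep L v w hw hα0 uη (E₂ (t : ((cmDatum L 2 (Matrix.of fun i j : Fin 2 => if i.val + j.val + 1 = 2 then (1 : L) else 0)).Local v × (cmDatum L 1 (Matrix.of fun i j : Fin 1 => if i.val + j.val + 1 = 1 then (1 : L) else 0)).Local v)).1) hηE0 huη hc0 hc m u₀ v₀ 1 (bF t / aF t) hγ₁ hTγ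
    have h1 : (∫ k in (((K).prod (⊤ : Subgroup ((cmDatum L 1 (Matrix.of fun i j : Fin 1 => if i.val + j.val + 1 = 1 then (1 : L) else 0)).Local v)) : Subgroup ((cmDatum L 2 (Matrix.of fun i j : Fin 2 => if i.val + j.val + 1 = 2 then (1 : L) else 0)).Local v × (cmDatum L 1 (Matrix.of fun i j : Fin 1 => if i.val + j.val + 1 = 1 then (1 : L) else 0)).Local v)) : Set ((cmDatum L 2 (Matrix.of fun i j : Fin 2 => if i.val + j.val + 1 = 2 then (1 : L) else 0)).Local v × (cmDatum L 1 (Matrix.of fun i j : Fin 1 => if i.val + j.val + 1 = 1 then (1 : L) else 0)).Local v)), f (k⁻¹ * (((E₂.symm (uη⁻¹ ^ (m)), (1 : (cmDatum L 1 (Matrix.of fun i j : Fin 1 => if i.val + j.val + 1 = 1 then (1 : L) else 0)).Local v)) : ((cmDatum L 2 (Matrix.of fun i j : Fin 2 => if i.val + j.val + 1 = 2 then (1 : L) else 0)).Local v × (cmDatum L 1 (Matrix.of fun i j : Fin 1 => if i.val + j.val + 1 = 1 then (1 : L) else 0)).Local v))⁻¹ * ((t : ((cmDatum L 2 (Matrix.of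 fun i j : Fin 2 => if i.val + j.val + 1 = 2 then (1 : L) else 0)).Local v × (cmDatum L 1 (Matrix.of fun i j : Fin 1 => if i.val + j.val + 1 = 1 then (1 : L) else 0)).Local v))) * (E₂.symm (uη⁻¹ ^ (m)), 1)) * k) ∂ν) = 0 := by
      refine hR m (oT t) (t : ((cmDatum L 2 (Matrix.of fun i j : Fin 2 => if i.val + j.val + 1 = 2 then (1 : L) else 0)).Local v × (cmDatum L 1 (Matrix.of fun i j : Fin 1 => if i.val + j.val + 1 = 1 then (1 : L) else 0)).Local v)) (s := ((((E₂ (t : ((cmDatum L 2 (Matrix.of fun i j : Fin 2 => if i.val + j.val + 1 = 2 then (1 : L) else 0)).Local v × (cmDatum L 1 (Matrix.of fun i j : Fin 1 => if i.val + j.val + 1 = 1 then (1 : L) else 0)).Local v)).1 : ↥(unitaryGroupOfForm (galAdicCompletionMap (L := L) (IsCMField.complexConj L) hw) (placeForm (Matrix.of fun i j : Fin 2 => if i.val + j.val + 1 = 2 then (1 : L) else 0) w.1))) : GL (Fin 2) (w.1.adicCompletion L)) : Matrix (Fin 2) (Fin 2) (w.1.adicCompletion L))) 0 0) (D := 1)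 (one_mem _) ?_ hoTval hlt
      rw [inv_one, Units.val_one, Matrix.one_mul, Matrix.mul_one]
      exact hXm
    -- `e t`: the `D = D_uF` form
    have hd1 : (((glDiagonal 2 (w.1.adicCompletion L) ![1, u]) : GL (Fin 2) (w.1.adicCompletion L)) : Matrix (Fin 2) (Fin 2) (w.1.adicCompletion L)) = Matrix.diagonal ![1, toPlace v w uF] := by
      rw [coe_glDiagonal]; congr 1; funext k; fin_cases k <;> simp [huu]
    have hd2 : ((((glDiagonal 2 (w.1.adicCompletion L) ![1, u]))⁻¹ : GL (Fin 2) (w.1.adicCompletion L)) : Matrix (Fin 2) (Fin 2) (w.1.adicCompletion L)) = Matrix.diagonal ![1, (toPlace v w uF)⁻¹] := by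
      rw [← map_inv, coe_glDiagonal]; congr 1; funext k; fin_cases k <;> simp [huu]
    have hT'mat : ((((E₂ (e (t : ((cmDatum L 2 (Matrix.of fun i j : Fin 2 => if i.val + j.val + 1 = 2 then (1 : L) else 0)).Local v × (cmDatum L 1 (Matrix.of fun i j : Fin 1 => if i.val + j.val + 1 = 1 then (1 : L) else 0)).Local v))).1 : ↥(unitaryGroupOfForm (galAdicCompletionMap (L := L) (IsCMField.complexConj L) hw) (placeForm (Matrix.of fun i j : Fin 2 => if i.val + j.val + 1 = 2 then (1 : L) else 0) w.1))) : GL (Fin 2) (w.1.adicCompletion L)) : Matrix (Fin 2) (Fin 2) (w.1.adicCompletion L))) = Matrix.diagonal ![1, toPlace v w uF] * ((((E₂ (t : ((cmDatum L 2 (Matrix.of fun i j : Fin 2 => if i.val + j.val + 1 = 2 then (1 : L) else 0)).Local v × (cmDatum L 1 (Matrix.of fun i j : Fin 1 => if i.val + j.val + 1 = 1 then (1 : L) else 0)).Local v)).1 : ↥(unitaryGroupOfForm (galAdicCompletionMap (L := L) (IsCMField.complexConj L) hw) (placeForm (Matrix.of fun i j : Fin 2 => if i.val + j.val + 1 = 2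 then (1 : L) else 0) w.1))) : GL (Fin 2) (w.1.adicCompletion L)) : Matrix (Fin 2) (Fin 2) (w.1.adicCompletion L))) * Matrix.diagonal ![1, (toPlace v w uF)⁻¹] := by
      rw [hconj (t : ((cmDatum L 2 (Matrix.of fun i j : Fin 2 => if i.val + j.val + 1 = 2 then (1 : L) else 0)).Local v × (cmDatum L 1 (Matrix.of fun i j : Fin 1 => if i.val + j.val + 1 = 1 then (1 : L) else 0)).Local v)), Units.val_mul, Units.val_mul, hd1, hd2]
    have hcD1 : (((glDiagonal 2 (v.adicCompletion ↥(maximalRealSubfield L)) ![1, Units.mk0 (uF) (huF0)]) : GL (Fin 2) (v.adicCompletion ↥(maximalRealSubfield L))) : Matrix (Fin 2) (Fin 2) (v.adicCompletion ↥(maximalRealSubfield L))) = Matrix.diagonal ![1, uF] := by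
      rw [coe_glDiagonal]; congr 1; funext k; fin_cases k <;> simp
    have hcD2 : ((((glDiagonal 2 (v.adicCompletion ↥(maximalRealSubfield L)) ![1, Units.mk0 (uF) (huF0)]))⁻¹ : GL (Fin 2) (v.adicCompletion ↥(maximalRealSubfield L))) : Matrix (Fin 2) (Fin 2) (v.adicCompletion ↥(maximalRealSubfield L))) = Matrix.diagonal ![1, uF⁻¹] := by
      rw [← map_inv, coe_glDiagonal]; congr 1; funext k; fin_cases k <;> simp
    have hT'desc : Matrix.diagonal ![1, α] * ((((E₂ (e (t : ((cmDatum L 2 (Matrix.of fun i j : Fin 2 => if i.val + j.val + 1 = 2 then (1 : L) else 0)).Local v × (cmDatum L 1 (Matrix.of fun i j : Fin 1 => if i.val + j.val + 1 = 1 then (1 : L) else 0)).Local v))).1 : ↥(unitaryGroupOfForm (galAdicCompletionMap (L := L) (IsCMField.complexConj L) hw) (placeForm (Matrix.of fun i j : Fin 2 => if i.val + j.val + 1 = 2 then (1 : L) else 0) w.1))) : GL (Fin 2) (w.1.adicCompletion L)) : Matrix (Fin 2) (Fin 2) (w.1.adicCompletion L))) * Matrix.diagonal ![1, α⁻¹]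 = (((((E₂ (t : ((cmDatum L 2 (Matrix.of fun i j : Fin 2 => if i.val + j.val + 1 = 2 then (1 : L) else 0)).Local v × (cmDatum L 1 (Matrix.of fun i j : Fin 1 => if i.val + j.val + 1 = 1 then (1 : L) else 0)).Local v)).1 : ↥(unitaryGroupOfForm (galAdicCompletionMap (L := L) (IsCMField.complexConj L) hw) (placeForm (Matrix.of fun i j : Fin 2 => if i.val + j.val + 1 = 2 then (1 : L) else 0) w.1))) : GL (Fin 2) (w.1.adicCompletion L)) : Matrix (Fin 2) (Fin 2) (w.1.adicCompletion L))) 0 0) • ((((glDiagonal 2 (v.adicCompletion ↥(maximalRealSubfield L)) ![1, Units.mk0 (uF) (huF0)]) * γ₁ * (glDiagonal 2 (v.adicCompletion ↥(maximalRealSubfield L)) ![1, Units.mk0 (uF) (huF0)])⁻¹ : GL (Fin 2) (v.adicCompletion ↥(maximalRealSubfield L))) : Matrix (Fin 2) (Fin 2) (v.adicCompletion ↥(maximalRealSubfield L)))).map (toPlace v w) := by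
      rw [hT'mat, descent_conj_diagonal_eq (toPlace v w) α uF hTγ, Units.val_mul, Units.val_mul, hcD1, hcD2]
    have hS'₀ := descent_shellConjugate L v w hw hα0 uη (E₂ (e (t : ((cmDatum L 2 (Matrix.of fun i j : Fin 2 => if i.val + j.val + 1 = 2 then (1 : L) else 0)).Local v × (cmDatum L 1 (Matrix.of fun i j : Fin 1 => if i.val + j.val + 1 = 1 then (1 : L) else 0)).Local v))).1) hηE0 huη hc0 hc m hT'desc
    have hcomm : Commute ((glDiagonal 2 (v.adicCompletion ↥(maximalRealSubfield L)) ![1, Units.mk0 (c) (hc0)]) ^ m) (glDiagonal 2 (v.adicCompletion ↥(maximalRealSubfield L)) ![1, Units.mk0 (uF) (huF0)]) :=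
      (commute_glDiagonal 2 (v.adicCompletion ↥(maximalRealSubfield L)) _ _).pow_left m
    rw [conj_conj_eq_of_commute hcomm, Units.val_mul, Units.val_mul, coe_glDiagonal_pow_conj_regRep L v hc0 m u₀ v₀ 1 (bF t / aF t) hγ₁] at hS'₀
    have h2 : (∫ k in (((K).prod (⊤ : Subgroup ((cmDatum L 1 (Matrix.of fun i j : Fin 1 => if i.val + j.val + 1 = 1 then (1 : L) else 0)).Local v)) : Subgroup ((cmDatum L 2 (Matrix.of fun i j : Fin 2 => if i.val + j.val + 1 = 2 then (1 : L) else 0)).Local v × (cmDatum L 1 (Matrix.of fun i j : Fin 1 => if i.val + j.val + 1 = 1 then (1 : L) else 0)).Local v)) : Set ((cmDatum L 2 (Matrix.of fun i j : Fin 2 => if i.val + j.val + 1 = 2 then (1 : L) else 0)).Local v × (cmDatum L 1 (Matrix.of fun i j : Fin 1 => if i.val + j.val + 1 = 1 then (1 : L) else 0)).Local v)), f (k⁻¹ * (((E₂.symm (uη⁻¹ ^ (m)), (1 : (cmDatum L 1 (Matrix.of fun i j : Fin 1 => if i.val + j.val + 1 = 1 then (1 : L) else 0)).Local v)) : ((cmDatum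 L 2 (Matrix.of fun i j : Fin 2 => if i.val + j.val + 1 = 2 then (1 : L) else 0)).Local v × (cmDatum L 1 (Matrix.of fun i j : Fin 1 => if i.val + j.val + 1 = 1 then (1 : L) else 0)).Local v))⁻¹ * (e (t : ((cmDatum L 2 (Matrix.of fun i j : Fin 2 => if i.val + j.val + 1 = 2 then (1 : L) else 0)).Local v × (cmDatum L 1 (Matrix.of fun i j : Fin 1 => if i.val + j.val + 1 = 1 then (1 : L) else 0)).Local v))) * (E₂.symm (uη⁻¹ ^ (m)), 1)) * k) ∂ν) = 0 := by
      refine hR m (oT t) (e (t : ((cmDatum L 2 (Matrix.of fun i j : Fin 2 => if i.val + j.val + 1 = 2 then (1 : L) else 0)).Local v × (cmDatum L 1 (Matrix.of fun i j : Fin 1 => if i.val + j.val + 1 = 1 then (1 : L) else 0)).Local v))) (s := ((((E₂ (t : ((cmDatum L 2 (Matrix.of fun i j : Fin 2 => if i.val + j.val + 1 = 2 then (1 : L) else 0)).Local v × (cmDatum L 1 (Matrix.of fun i j : Fin 1 => if i.val + j.val + 1 = 1 then (1 : L) else 0)).Local v)).1 : ↥(unitaryGroupOfForm (galAdicCompletionMap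 (L := L) (IsCMField.complexConj L) hw) (placeForm (Matrix.of fun i j : Fin 2 => if i.val + j.val + 1 = 2 then (1 : L) else 0) w.1))) : GL (Fin 2) (w.1.adicCompletion L)) : Matrix (Fin 2) (Fin 2) (w.1.adicCompletion L))) 0 0) (D := glDiagonal 2 (v.adicCompletion ↥(maximalRealSubfield L)) ![1, Units.mk0 (uF) (huF0)]) ?_ hS'₀ hoTval hlt
      rw [Literature.NumberTheory.Automorphic.mem_glInt_iff_forall_v_le_one, hcD1, hcD2]
      constructor <;> intro i k <;> fin_cases i <;> fin_cases k <;> simp [huFv]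
    exact ⟨h1, h2⟩
  /- §9 ASSEMBLY through ★ B-p14 (g34) `exists_wildValueLaws_of_frontHalf` (window side `hwin hΦ hΦD hcont` + `hjo hspec` bookkeeping are ★ there) -/
  have hnf : ∀ t : ↥(Subgroup.centralizer ({t₀} : Set ((cmDatum L 2 (Matrix.of fun i j : Fin 2 => if i.val + j.val + 1 = 2 then (1 : L) else 0)).Local v × (cmDatum L 1 (Matrix.of fun i j : Fin 1 => if i.val + j.val + 1 = 1 then (1 : L) else 0)).Local v))), ((((E₂ (t : ((cmDatum L 2 (Matrix.of fun i j : Fin 2 => if i.val + j.val + 1 = 2 then (1 : L) else 0)).Local v × (cmDatum L 1 (Matrix.of fun i j : Fin 1 => if i.val + j.val + 1 = 1 then (1 : L) else 0)).Local v)).1 : ↥(unitaryGroupOfForm (galAdicCompletionMap (L := L) (IsCMField.complexConj L) hw) (placeForm (Matrix.of fun i j : Fin 2 => if i.val + j.val + 1 = 2 then (1 : L) else 0) w.1))) : GL (Fin 2) (w.1.adicCompletion L)) : Matrix (Fin 2) (Fin 2) (w.1.adicCompletion L))) 0 0 ≠ 0 →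
      Matrix.diagonal ![1, α] * ((((E₂ (t : ((cmDatum L 2 (Matrix.of fun i j : Fin 2 => if i.val + j.val + 1 = 2 then (1 : L) else 0)).Local v × (cmDatum L 1 (Matrix.of fun i j : Fin 1 => if i.val + j.val + 1 = 1 then (1 : L) else 0)).Local v)).1 : ↥(unitaryGroupOfForm (galAdicCompletionMap (L := L) (IsCMField.complexConj L) hw) (placeForm (Matrix.of fun i j : Fin 2 => if i.val + j.val + 1 = 2 then (1 : L) else 0) w.1))) : GL (Fin 2) (w.1.adicCompletion L)) : Matrix (Fin 2) (Fin 2) (w.1.adicCompletion L))) * Matrix.diagonal ![1, α⁻¹] = (fun t' : ↥(Subgroup.centralizer ({t₀} : Set ((cmDatum L 2 (Matrix.of fun i j : Fin 2 => if i.val + j.val + 1 = 2 then (1 : L) else 0)).Local v × (cmDatum L 1 (Matrix.of fun i j : Fin 1 => if i.val + j.val + 1 = 1 then (1 : L) else 0)).Local v))) => ((((E₂ (t' : ((cmDatum L 2 (Matrix.of fun i j : Fin 2 => if i.val + j.val + 1 = 2 then (1 : L) else 0)).Local v × (cmDatum L 1 (Matrix.of fun i j : Fin 1 => if i.val + j.val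 + 1 = 1 then (1 : L) else 0)).Local v)).1 : ↥(unitaryGroupOfForm (galAdicCompletionMap (L := L) (IsCMField.complexConj L) hw) (placeForm (Matrix.of fun i j : Fin 2 => if i.val + j.val + 1 = 2 then (1 : L) else 0) w.1))) : GL (Fin 2) (w.1.adicCompletion L)) : Matrix (Fin 2) (Fin 2) (w.1.adicCompletion L))) 0 0) t • (!![(1 : (v.adicCompletion ↥(maximalRealSubfield L))), β t * v₀; β t, 1 + β t * u₀]).map (toPlace v w) := by
    intro t h; rw [hβdef t]; exact hN1 t h
  exact exists_wildValueLaws_of_frontHalf L v w hw ν f t₀ P d ht₀ hP hd1 he u hvu hσu hun E₂ hE₂ e he2 hconj hα hα0 hϖF K x₀ hx₀ hK hKo ηE hηE uη huη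
    mfl jD R (fun t' : ↥(Subgroup.centralizer ({t₀} : Set ((cmDatum L 2 (Matrix.of fun i j : Fin 2 => if i.val + j.val + 1 = 2 then (1 : L) else 0)).Local v × (cmDatum L 1 (Matrix.of fun i j : Fin 1 => if i.val + j.val + 1 = 1 then (1 : L) else 0)).Local v))) => ((((E₂ (t' : ((cmDatum L 2 (Matrix.of fun i j : Fin 2 => if i.val + j.val + 1 = 2 then (1 : L) else 0)).Local v × (cmDatum L 1 (Matrix.of fun i j : Fin 1 => if i.val + j.val + 1 = 1 then (1 : L) else 0)).Local v)).1 : ↥(unitaryGroupOfForm (galAdicCompletionMap (L := L) (IsCMField.complexConj L) hw) (placeForm (Matrix.of fun i j : Fin 2 => if i.val + j.val + 1 = 2 then (1 : L) else 0) w.1))) : GL (Fin 2) (w.1.adicCompletion L)) : Matrix (Fin 2) (Fin 2) (w.1.adicCompletion L))) 0 0) β oT hnf (fun t ht hm => (hdeepT t ht hm).1) (fun t ht hm => ⟨(hdeepT t ht hm).2.2.2.2, (hdeepT t ht hm).2.2.1⟩) hdeep htop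

end ValueLaws

end Literature.NumberTheory.Rogawski1990

end
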